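import Literature.InformationTheory.QuantumCodes.CSSPuncturing
import Literature.InformationTheory.QuantumCodes.CSSStabilizer
import Mathlib.Algebra.CharP.Two
import Mathlib.Combinatorics.Enumerative.DoubleCounting
import HarnessLib

/-!
# CSS codes with check weight three have distance at most two (Wang–Liu–Li–Kubica–Gu 2026, Theorem III.4)

LADDER-QEC, X1 (barriers), check-weight axis. Wang–Liu–Li–Kubica–Gu, *Check-weight-constrained quantum codes:
bounds and examples* (arXiv:2601.15446, 2026), §III.A, prove: **Theorem III.4.** «An `[[n, k, d]]` CSS code with check
weight 3 must have either distance `d ≤ 2` or dimension `k = 0`» (p. 5) — with NO hypothesis on the qubit degree or on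
the number of checks. This file proves it, AS PRINTED, in the check-matrix language of `CSS.lean` (type-02's
`CSSCode RX RZ Q`: binary check matrices `H^X`, `H^Z` with `H^X (H^Z)ᵀ = 0`; `dX`, `dZ`, `k`; `CSSCode.IsCode`):

* **`CSSCode.WangLiuLiKubicaGu2026_theorem_III4`** — if every row of `H^X` and of `H^Z` has Hamming weight `≤ 3` and
  `0 < k`, then `min (d^X, d^Z) ≤ 2`;
* **`CSSCode.WangLiuLiKubicaGu2026_theorem_III4_isCode`** — an `[[n, k, d]]` CSS code (`IsCode`, so `k > 0` and
  `d = min (d^X, d^Z)`) with check weight `≤ 3` has `d ≤ 2`.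

## The printed proof and how it is run here

The paper argues on a MINIMAL code of the class `CSS(3)` (check weight 3, `k > 0`, `d > 2`): minimal number of qubits,
then minimal total check weight `wt(C) = Σ_i |S_i|` (Definitions III.1–III.2, p. 4); Lemma III.3 (pp. 4–5) lists the
structure minimality forces — (1) every qubit is in an `X`- and a `Z`-check, (2) two checks of the same type share
`≤ 1` qubit, (3) every qubit is in `≤ 2` checks of each type, (4) the number `t` of intersecting same-type pairs is
`≥ r₃` — and the proof of Theorem III.4 (p. 5) counts `2n = 3r₃ + 2r₂ − t ≤ 2r`, so `k = 0` «as all checks are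
independent». This file FOLLOWS THAT PROOF, organised as a strong induction on the descent parameter
`meas C = n + wt(C)` (`min_dX_dZ_le_two_of_meas_le`) instead of a choice of a minimal code: every use of minimality
in the paper becomes a REDUCTION STEP to a code with smaller parameter, the same `k > 0`, check weight `≤ 3` and
distances not smaller, to which the induction hypothesis (`DescentIH`) applies —

* `step_punctureX/Z` — a weight-one stabilizer `X_q`/`Z_q` («qubit 1 is disentangled», proof of III.3 (1)):
  puncture at `q`, the CSS form of CRSS Thm. 6 (e) already in the tree (`CSSPuncturing.lean`, `puncture_params`);
* `step_exchX/Z` — replace a check by a strictly lighter stabilizer from which it is recovered (`exchX`; proof of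
  III.3 (2) «replace one of them by the product», redundant checks, and «it cannot be a product of weight-3 checks
  by minimality» in III.3 (4)); the stabilizer group, hence `k, d^X, d^Z`, is unchanged (`rowSpX_exchX_eq`);
* `step_punctureSet` — «a subset of disentangled qubits … a smaller code with the same dimension and distance»
  (p. 4): Part A builds the puncturing of a CSS code on a SET `P` of qubits whose `P`-parts of all checks are
  stabilizers (`punctureSet`), proves `d^X`, `d^Z` do not drop (`dX_le_dX_punctureSet`) and `k` stays positive
  when no `X`-logical lives inside `P` (`k_punctureSet_pos`); used for the Bell pair `{a,b}` (`X_aX_b, Z_aZ_b ∈ S`)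
  and the triple `{a,b,c}` (`Z_aZ_bZ_c, X_aX_b, X_aX_c ∈ S`) of the proof of III.3 (4);
* `step_logicalX/Z` — an explicit logical of weight `≤ 2` («must be a stabilizer due to the distance»).

When no step applies, Part B.3 derives the structure of Lemma III.3 (`A_weights`, `A_share`, `A_rank`,
`A_deg_pos`, `A_deg_le_two`, `A_meet`, `A_partner` — the last two are the two cases of the proof of III.3 (4)) and
Part B.4 is the printed count: `count_identity` (eq. (1), per check type, in the form `Σ_r c(r) + 2n = 2 Σ_r |S_r|`
where `c(r)` = number of checks intersecting `S_r`, so `Σ c = 2t`), `charging` (Lemma III.3 (4) as the inequality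
`2r₃ ≤ Σ c`, the paper's injective «association» of two ordered pairs to each weight-3 check), and
`k_eq_zero_of_structure` (`2n ≤ 2r` ⟹ `k = n − rank H^X − rank H^Z = 0`). Deviations from print: none in content;
the `X ↔ Z` symmetric halves («the case of X checks is handled similarly») are obtained from `CSSCode.swap`.

SCOPE. CSS codes only (Theorem III.4). The general stabilizer-code statement (Theorem III.7, via the single-qubit
Clifford reduction of Lemmas III.5–III.6, pp. 5–7) is NOT formalized here. The paper notes (fn. 1, p. 4) the earlier
related results of Aharonov–Eldar 2011 (commuting 3-local Hamiltonians; constant but unquantified distance) and of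
Krishna–Tillich (unpublished); neither is used.

## References (locators read on the page)

* [WangLiuLiKubicaGu2026] L. Wang, A. Z. Liu, R. Li, A. Kubica, S. Gu, *Check-weight-constrained quantum codes:
  bounds and examples*, arXiv:2601.15446 (2026): §III.A Definitions III.1–III.2 (held text p0004 L62–80), Lemma III.3
  and proof (p0004 L99 – p0005 L61), Theorem III.4 and proof (p0005 L62–80, eqs. (1)–(2)).
* [CalderbankEtAl1998] Calderbank–Rains–Shor–Sloane, IEEE Trans. IT 44 (1998) 1369, §4 Thm. 6 (e) — the one-qubit
  puncturing (`CSSPuncturing.lean`).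
* [NielsenChuang2010] Nielsen–Chuang, CUP 2010, §10.4.1–10.4.2 (row space / kernel of a check matrix; `k₁ − k₂`).

## Mathlib / tree search (2026-08-27)

`rg`/`lean search` for check weight / weight-3 / Wang–Kubica / Aharonov–Eldar in `Literature`, `Summits`: nothing
(the result is new to the tree). Reused: `CSSCode`, `dX/dZ/k`, `k_eq`, `dX_le_hammingNorm`, `le_dX`, `dX_pos_iff`,
`IsCode`, `isCode_iff` (`CSS.lean`, `CSSParameters.lean`); `puncture`, `puncture_params` (`CSSPuncturing.lean`);
`row_mem_rowSpace` (`CSSStabilizer.lean`); Mathlib `hammingNorm`, `Matrix.updateRow`, `linearIndepOn_iff_notMem_span`,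
`finrank_span_eq_card`, `Finset.card_biUnion`, `Finset.card_le_card_of_forall_subsingleton`, `Finset.card_nsmul_le_sum`.
The binary-vector helpers `supp₂` / `ind₂` (support / indicator; `MinWeightDecodingClusters.supp` is the same notion
on the decoding side, with private API and heavier imports) are plumbing.
-/

namespace Literature.InformationTheory.QuantumCodes

open Matrix Finset

namespace CSSCode

variable {RX RZ Q : Type*} [Fintype RX] [Fintype RZ] [Fintype Q] [DecidableEq Q]

/-! ## Part A. Puncturing a disentangled SET of qubits (the «smaller code with the same dimension and distance») -/

section PunctureSet

/-- Keep the coordinates in `P`, zero elsewhere (linear). Plumbing definition.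
[cite: WangLiuLiKubicaGu2026, §III.A (arXiv:2601.15446 p. 4: «any minimal code … does not contain any subset of disentangled qubits since otherwise, there would be a smaller code with the same dimension and distance»)] -/
def maskOn (P : Finset Q) : (Q → ZMod 2) →ₗ[ZMod 2] (Q → ZMod 2) where
  toFun w p := if p ∈ P then w p else 0
  map_add' u w := by funext p; by_cases hp : p ∈ P <;> simp [hp]
  map_smul' a w := by funext p; by_cases hp : p ∈ P <;> simp [hp]

omit [Fintype Q] in
/-- Value of `maskOn`. [cite: WangLiuLiKubicaGu2026, §III.A (arXiv:2601.15446 p. 4, disentangled qubits)] -/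
@[simp] theorem maskOn_apply (P : Finset Q) (w : Q → ZMod 2) (p : Q) :
    maskOn P w p = if p ∈ P then w p else 0 := rfl

/-- Restriction to the qubits outside `P` (linear). Plumbing definition.
[cite: WangLiuLiKubicaGu2026, §III.A (arXiv:2601.15446 p. 4, disentangled qubits)] -/
def restrictOff (P : Finset Q) : (Q → ZMod 2) →ₗ[ZMod 2] ({p : Q // p ∉ P} → ZMod 2) where
  toFun w p := w p.1
  map_add' _ _ := rfl
  map_smul' _ _ := rfl

omit [Fintype Q] [DecidableEq Q] in
/-- Value of `restrictOff`. [cite: WangLiuLiKubicaGu2026, §III.A (arXiv:2601.15446 p. 4, disentangled qubits)] -/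
@[simp] theorem restrictOff_apply (P : Finset Q) (w : Q → ZMod 2) (p : {p : Q // p ∉ P}) :
    restrictOff P w p = w p.1 := rfl

/-- Extension by zero on `P`. Plumbing definition. [cite: WangLiuLiKubicaGu2026, §III.A (arXiv:2601.15446 p. 4, disentangled qubits)] -/
def extendOff (P : Finset Q) (v : {p : Q // p ∉ P} → ZMod 2) : Q → ZMod 2 :=
  fun p => if h : p ∈ P then 0 else v ⟨p, h⟩

omit [Fintype Q] in
/-- `extendOff` vanishes on `P`. [cite: WangLiuLiKubicaGu2026, §III.A (arXiv:2601.15446 p. 4, disentangled qubits)] -/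
@[simp] theorem extendOff_of_mem (P : Finset Q) (v : {p : Q // p ∉ P} → ZMod 2) {p : Q} (hp : p ∈ P) :
    extendOff P v p = 0 := by
  simp [extendOff, hp]

omit [Fintype Q] in
/-- `extendOff` agrees with `v` off `P`. [cite: WangLiuLiKubicaGu2026, §III.A (arXiv:2601.15446 p. 4, disentangled qubits)] -/
@[simp] theorem extendOff_val (P : Finset Q) (v : {p : Q // p ∉ P} → ZMod 2) (p : {p : Q // p ∉ P}) :
    extendOff P v p.1 = v p := by
  simp [extendOff, p.2]

omit [Fintype Q] in
/-- Restricting the extension gives back `v`. [cite: WangLiuLiKubicaGu2026, §III.A (arXiv:2601.15446 p. 4, disentangled qubits)] -/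
@[simp] theorem restrictOff_extendOff (P : Finset Q) (v : {p : Q // p ∉ P} → ZMod 2) :
    restrictOff P (extendOff P v) = v := by
  funext p; exact extendOff_val P v p

omit [Fintype Q] in
/-- A vector vanishing on `P` is the extension of its restriction. [cite: WangLiuLiKubicaGu2026, §III.A (arXiv:2601.15446 p. 4, disentangled qubits)] -/
theorem extendOff_restrictOff (P : Finset Q) {w : Q → ZMod 2} (hw : ∀ p ∈ P, w p = 0) :
    extendOff P (restrictOff P w) = w := by
  funext p
  by_cases hp : p ∈ P
  · rw [extendOff_of_mem P _ hp, hw p hp]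
  · exact extendOff_val P _ ⟨p, hp⟩

omit [Fintype Q] in
/-- `w − maskOn P w` vanishes on `P`. [cite: WangLiuLiKubicaGu2026, §III.A (arXiv:2601.15446 p. 4, disentangled qubits)] -/
theorem sub_maskOn_apply_of_mem (P : Finset Q) (w : Q → ZMod 2) {p : Q} (hp : p ∈ P) : (w - maskOn P w) p = 0 := by
  simp [hp]

omit [Fintype Q] in
/-- `maskOn P w` vanishes off `P`. [cite: WangLiuLiKubicaGu2026, §III.A (arXiv:2601.15446 p. 4, disentangled qubits)] -/
theorem maskOn_apply_of_not_mem (P : Finset Q) (w : Q → ZMod 2) {p : Q} (hp : p ∉ P) : maskOn P w p = 0 := by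
  simp [hp]

omit [Fintype Q] in
/-- Restricting `w − maskOn P w` is restricting `w`. [cite: WangLiuLiKubicaGu2026, §III.A (arXiv:2601.15446 p. 4, disentangled qubits)] -/
@[simp] theorem restrictOff_sub_maskOn (P : Finset Q) (w : Q → ZMod 2) :
    restrictOff P (w - maskOn P w) = restrictOff P w := by
  funext p; simp [p.2]

/-- The extension by zero has the same Hamming weight. [cite: WangLiuLiKubicaGu2026, §III.A (arXiv:2601.15446 p. 4, disentangled qubits)] -/
theorem hammingNorm_extendOff (P : Finset Q) (v : {p : Q // p ∉ P} → ZMod 2) :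
    hammingNorm (extendOff P v) = hammingNorm v := by
  unfold hammingNorm
  have hset : (univ.filter fun i : Q => extendOff P v i ≠ 0) =
      (univ.filter fun p : {p : Q // p ∉ P} => v p ≠ 0).map (Function.Embedding.subtype _) := by
    ext i
    simp only [mem_filter, mem_univ, true_and, mem_map, Function.Embedding.coe_subtype]
    constructor
    · intro hi
      have hiq : i ∉ P := fun h => hi (extendOff_of_mem P v h)
      exact ⟨⟨i, hiq⟩, by rwa [← extendOff_val P v ⟨i, hiq⟩], rfl⟩
    · rintro ⟨p, hp, rfl⟩
      rwa [extendOff_val]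
  rw [hset, card_map]

/-- Deleting columns does not increase a row's weight. [cite: WangLiuLiKubicaGu2026, §III.A (arXiv:2601.15446 p. 4, disentangled qubits)] -/
theorem hammingNorm_restrictOff_le (P : Finset Q) (w : Q → ZMod 2) : hammingNorm (restrictOff P w) ≤ hammingNorm w := by
  unfold hammingNorm
  have hsub : (univ.filter fun p : {p : Q // p ∉ P} => restrictOff P w p ≠ 0).map (Function.Embedding.subtype _) ⊆
      univ.filter fun i : Q => w i ≠ 0 := by
    intro i hi
    simp only [mem_map, mem_filter, mem_univ, true_and, Function.Embedding.coe_subtype] at hi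
    obtain ⟨p, hp, rfl⟩ := hi
    exact mem_filter.2 ⟨mem_univ _, hp⟩
  exact le_trans (card_map _).ge (card_le_card hsub)

/-- A sum over the qubits outside `P` is the full sum of the vector with the `P`-coordinates zeroed. [folklore] -/
private theorem sum_subtype_notMem (P : Finset Q) (g : Q → ZMod 2) :
    ∑ p : {p : Q // p ∉ P}, g p.1 = ∑ p, (if p ∈ P then 0 else g p) := by
  rw [← sum_subtype (univ.filter fun p => p ∉ P) (by simp) g, sum_filter]
  refine sum_congr rfl fun p _ => ?_
  by_cases hp : p ∈ P <;> simp [hp]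

/-- `H' *ᵥ v = H *ᵥ (extendOff P v)` for the column-deleted matrix `H'`. [cite: WangLiuLiKubicaGu2026, §III.A (arXiv:2601.15446 p. 4, disentangled qubits)] -/
theorem submatrix_mulVec_eq_mulVec_extendOff {R : Type*} (H : Matrix R Q (ZMod 2)) (P : Finset Q)
    (v : {p : Q // p ∉ P} → ZMod 2) :
    (H.submatrix id (Subtype.val : {p : Q // p ∉ P} → Q)) *ᵥ v = H *ᵥ extendOff P v := by
  funext r
  simp only [Matrix.mulVec, dotProduct, Matrix.submatrix_apply, id_eq]
  have h1 := sum_subtype_notMem P (fun x => H r x * extendOff P v x)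
  rw [show (∑ p : {p : Q // p ∉ P}, H r p.1 * v p) = ∑ p : {p : Q // p ∉ P}, H r p.1 * extendOff P v p.1 by simp, h1]
  refine sum_congr rfl fun p _ => ?_
  by_cases hp : p ∈ P <;> simp [hp]

omit [Fintype Q] [DecidableEq Q] in
/-- The row space of the column-deleted matrix is the restriction of the row space. [cite: WangLiuLiKubicaGu2026, §III.A (arXiv:2601.15446 p. 4, disentangled qubits)] -/
theorem rowSpace_submatrix_eq_map_restrictOff {R : Type*} [Fintype R] (H : Matrix R Q (ZMod 2)) (P : Finset Q) :
    rowSpace (H.submatrix id (Subtype.val : {p : Q // p ∉ P} → Q)) = (rowSpace H).map (restrictOff P) := by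
  ext v
  rw [Submodule.mem_map]
  constructor
  · intro hv
    obtain ⟨c, rfl⟩ := (mem_rowSpace_iff _ _).1 hv
    refine ⟨c ᵥ* H, (mem_rowSpace_iff _ _).2 ⟨c, rfl⟩, ?_⟩
    funext p; simp [Matrix.vecMul, dotProduct, Matrix.submatrix_apply]
  · rintro ⟨w, hw, rfl⟩
    obtain ⟨c, rfl⟩ := (mem_rowSpace_iff H _).1 hw
    exact (mem_rowSpace_iff _ _).2 ⟨c, by funext p; simp [Matrix.vecMul, dotProduct, Matrix.submatrix_apply]⟩

/-- The `s`-th syndrome bit of `maskOn P u` is `Σ_{p ∈ P} H_{sp} u_p`, i.e. the syndrome of `u` against the masked row.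
[cite: WangLiuLiKubicaGu2026, §III.A (arXiv:2601.15446 p. 4, disentangled qubits)] -/
theorem mulVec_maskOn_apply {R : Type*} (H : Matrix R Q (ZMod 2)) (P : Finset Q) (u : Q → ZMod 2) (s : R) :
    (H *ᵥ maskOn P u) s = u ⬝ᵥ maskOn P (H s) := by
  simp only [Matrix.mulVec, dotProduct, maskOn_apply]
  refine sum_congr rfl fun p _ => ?_
  by_cases hp : p ∈ P <;> simp [hp, mul_comm]

omit [Fintype Q] in
/-- `maskOn P` maps the row space into itself as soon as it maps every row into the row space.
[cite: WangLiuLiKubicaGu2026, §III.A (arXiv:2601.15446 p. 4, disentangled qubits)] -/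
theorem maskOn_mem_rowSpace {R : Type*} [Fintype R] (H : Matrix R Q (ZMod 2)) (P : Finset Q)
    (hrows : ∀ r, maskOn P (H r) ∈ rowSpace H) {w : Q → ZMod 2} (hw : w ∈ rowSpace H) : maskOn P w ∈ rowSpace H := by
  obtain ⟨c, rfl⟩ := (mem_rowSpace_iff H w).1 hw
  have : c ᵥ* H = ∑ r, c r • H r := by
    funext p; simp [Matrix.vecMul, dotProduct, Finset.sum_apply]
  rw [this, map_sum]
  exact Submodule.sum_mem _ fun r _ => by rw [map_smul]; exact Submodule.smul_mem _ _ (hrows r)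

/-- **The CSS code punctured on a set `P` of qubits.** If the `P`-part of every `X`-check is an `X`-stabilizer and the
`P`-part of every `Z`-check is a `Z`-stabilizer (the qubits in `P` are «disentangled»: the stabilizer group splits along
`P ⊔ Pᶜ`), deleting the columns `P` from both check matrices is again a CSS code. [cite: WangLiuLiKubicaGu2026, §III.A (arXiv:2601.15446 p. 4: «there would be a smaller code with the same dimension and distance»)] -/
def punctureSet (C : CSSCode RX RZ Q) (P : Finset Q) (hX : ∀ r, maskOn P (C.HX r) ∈ C.rowSpX)
    (_hZ : ∀ s, maskOn P (C.HZ s) ∈ C.rowSpZ) : CSSCode RX RZ {p : Q // p ∉ P} :=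
  ofMatrices (C.HX.submatrix id Subtype.val) (C.HZ.submatrix id Subtype.val) (by
    ext r s
    have hc := congrFun (congrFun C.comm r) s
    simp only [Matrix.mul_apply, Matrix.transpose_apply, Matrix.submatrix_apply, id_eq, Matrix.zero_apply] at hc ⊢
    -- the masked `X`-row is an `X`-stabilizer, hence in `ker H^Z`: its `s`-syndrome `Σ_{p ∈ P} x_p z_p` vanishes
    have hk : (C.HZ *ᵥ maskOn P (C.HX r)) s = 0 := by
      have := C.rowSpX_le_kerZ (hX r); rw [mem_kerZ_iff] at this; rw [this]; rfl
    rw [mulVec_maskOn_apply] at hk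
    simp only [dotProduct, maskOn_apply] at hk
    rw [sum_subtype_notMem P (fun p => C.HX r p * C.HZ s p)]
    have hsplit : ∑ p, C.HX r p * C.HZ s p =
        (∑ p, (if p ∈ P then 0 else C.HX r p * C.HZ s p)) + ∑ p, C.HX r p * (if p ∈ P then C.HZ s p else 0) := by
      rw [← sum_add_distrib]
      refine sum_congr rfl fun p _ => ?_
      by_cases hp : p ∈ P <;> simp [hp]
    rw [hsplit, hk, add_zero] at hc
    exact hc)

/-- The check matrices of the set-punctured code. [cite: WangLiuLiKubicaGu2026, §III.A (arXiv:2601.15446 p. 4, disentangled qubits)] -/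
@[simp] theorem punctureSet_HX (C : CSSCode RX RZ Q) (P : Finset Q) (hX : ∀ r, maskOn P (C.HX r) ∈ C.rowSpX)
    (hZ : ∀ s, maskOn P (C.HZ s) ∈ C.rowSpZ) : (C.punctureSet P hX hZ).HX = C.HX.submatrix id Subtype.val := rfl

/-- The check matrices of the set-punctured code. [cite: WangLiuLiKubicaGu2026, §III.A (arXiv:2601.15446 p. 4, disentangled qubits)] -/
@[simp] theorem punctureSet_HZ (C : CSSCode RX RZ Q) (P : Finset Q) (hX : ∀ r, maskOn P (C.HX r) ∈ C.rowSpX)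
    (hZ : ∀ s, maskOn P (C.HZ s) ∈ C.rowSpZ) : (C.punctureSet P hX hZ).HZ = C.HZ.submatrix id Subtype.val := rfl

/-- **`d^X` does not drop**: an `X`-logical of the punctured code extends by zero to an `X`-logical of `C` of the same
weight. [cite: WangLiuLiKubicaGu2026, §III.A (arXiv:2601.15446 p. 4: «the same dimension and distance»)] -/
theorem dX_le_dX_punctureSet (C : CSSCode RX RZ Q) (P : Finset Q) (hX : ∀ r, maskOn P (C.HX r) ∈ C.rowSpX)
    (hZ : ∀ s, maskOn P (C.HZ s) ∈ C.rowSpZ) (hk : 0 < (C.punctureSet P hX hZ).k) :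
    C.dX ≤ (C.punctureSet P hX hZ).dX := by
  set C' := C.punctureSet P hX hZ
  refine C'.le_dX ((C'.dX_pos_iff).1 (C'.dX_pos_of_k_pos hk)) ?_
  intro v hv hv'
  rw [punctureSet_HZ, submatrix_mulVec_eq_mulVec_extendOff] at hv
  change v ∉ rowSpace (C.HX.submatrix id Subtype.val) at hv'
  rw [← hammingNorm_extendOff P v]
  refine C.dX_le_hammingNorm hv fun h => hv' ?_
  rw [rowSpace_submatrix_eq_map_restrictOff]
  exact ⟨_, h, restrictOff_extendOff P v⟩

/-- **`d^Z` does not drop** likewise. [cite: WangLiuLiKubicaGu2026, §III.A (arXiv:2601.15446 p. 4: «the same dimension and distance»)] -/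
theorem dZ_le_dZ_punctureSet (C : CSSCode RX RZ Q) (P : Finset Q) (hX : ∀ r, maskOn P (C.HX r) ∈ C.rowSpX)
    (hZ : ∀ s, maskOn P (C.HZ s) ∈ C.rowSpZ) (hk : 0 < (C.punctureSet P hX hZ).k) :
    C.dZ ≤ (C.punctureSet P hX hZ).dZ := by
  set C' := C.punctureSet P hX hZ
  refine C'.le_dZ ((C'.dZ_pos_iff).1 (C'.dZ_pos_of_k_pos hk)) ?_
  intro v hv hv'
  rw [punctureSet_HX, submatrix_mulVec_eq_mulVec_extendOff] at hv
  change v ∉ rowSpace (C.HZ.submatrix id Subtype.val) at hv'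
  rw [← hammingNorm_extendOff P v]
  refine C.dZ_le_hammingNorm hv fun h => hv' ?_
  rw [rowSpace_submatrix_eq_map_restrictOff]
  exact ⟨_, h, restrictOff_extendOff P v⟩

/-- **The punctured code still encodes** (`k > 0`) provided no `X`-logical of `C` is supported inside `P` (every `X`-type
operator on `P` commuting with the `Z`-checks is an `X`-stabilizer): an `X`-logical `v` of `C` is cleaned off `P`
(`v − v|_P`, with `v|_P ∈ rs H^X`) and then restricts to an `X`-logical of the punctured code.
[cite: WangLiuLiKubicaGu2026, §III.A (arXiv:2601.15446 p. 4: «the same dimension and distance»)] -/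
theorem k_punctureSet_pos (C : CSSCode RX RZ Q) (P : Finset Q) (hX : ∀ r, maskOn P (C.HX r) ∈ C.rowSpX)
    (hZ : ∀ s, maskOn P (C.HZ s) ∈ C.rowSpZ)
    (hMX : ∀ u : Q → ZMod 2, (∀ p ∉ P, u p = 0) → C.HZ *ᵥ u = 0 → u ∈ C.rowSpX) (hk : 0 < C.k) :
    0 < (C.punctureSet P hX hZ).k := by
  set C' := C.punctureSet P hX hZ
  obtain ⟨v, hv, hv'⟩ := (C.dX_pos_iff).1 (C.dX_pos_of_k_pos hk)
  -- the `P`-part of `v` commutes with every `Z`-check, hence is an `X`-stabilizer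
  have hu : C.HZ *ᵥ maskOn P v = 0 := by
    funext s
    rw [mulVec_maskOn_apply, Pi.zero_apply]
    have h1 : v ⬝ᵥ C.HZ s = 0 := by
      have := congrFun hv s; rwa [Matrix.mulVec, dotProduct_comm] at this
    have h2 : v ⬝ᵥ (C.HZ s - maskOn P (C.HZ s)) = 0 :=
      dotProduct_eq_zero_of_mem_rowSpace (Submodule.sub_mem _ (row_mem_rowSpace C.HZ s) (hZ s)) hv
    rw [dotProduct_sub, h1, zero_sub, neg_eq_zero] at h2
    exact h2
  have huS : maskOn P v ∈ C.rowSpX := hMX _ (fun p hp => maskOn_apply_of_not_mem P v hp) hu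
  -- `w := v − v|_P` is an `X`-logical vanishing on `P`
  have hw : C.HZ *ᵥ (v - maskOn P v) = 0 := by rw [Matrix.mulVec_sub, hv, hu, sub_zero]
  have hw' : v - maskOn P v ∉ C.rowSpX := fun h => hv' (by simpa using Submodule.add_mem _ h huS)
  rw [pos_iff_ne_zero, Ne, k_eq_zero_iff_dX_eq_zero, ← Ne, ← pos_iff_ne_zero, dX_pos_iff]
  refine ⟨restrictOff P v, ?_, ?_⟩
  · rw [punctureSet_HZ, submatrix_mulVec_eq_mulVec_extendOff, ← restrictOff_sub_maskOn,
      extendOff_restrictOff P (fun p hp => sub_maskOn_apply_of_mem P v hp), hw]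
  · intro h
    change restrictOff P v ∈ rowSpace (C.HX.submatrix id Subtype.val) at h
    rw [rowSpace_submatrix_eq_map_restrictOff] at h
    obtain ⟨y, hy, hyv⟩ := h
    have hy' : y - maskOn P y ∈ C.rowSpX := Submodule.sub_mem _ hy (maskOn_mem_rowSpace C.HX P hX hy)
    have heq : y - maskOn P y = v - maskOn P v := by
      funext p
      by_cases hp : p ∈ P
      · rw [sub_maskOn_apply_of_mem P y hp, sub_maskOn_apply_of_mem P v hp]
      · have := congrFun hyv ⟨p, hp⟩
        simp only [restrictOff_apply] at this
        simp [hp, this]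
    exact hw' (heq ▸ hy')

/-- Fewer qubits after puncturing a nonempty set. [cite: WangLiuLiKubicaGu2026, §III.A (arXiv:2601.15446 p. 4, disentangled qubits)] -/
theorem card_punctureSet (P : Finset Q) : Fintype.card {p : Q // p ∉ P} = Fintype.card Q - #P := by
  rw [Fintype.card_subtype_compl, Fintype.card_coe]

end PunctureSet


/-! ## Part B.1  Binary vectors as supports; replacing a check by a lighter stabilizer -/

section Supports

/-- A nonzero element of `𝔽₂` is `1`. [folklore] -/
private theorem z2_eq_one_of_ne_zero {a : ZMod 2} (h : a ≠ 0) : a = 1 := by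
  revert a; decide

/-- The support of a binary vector (its cardinality is `hammingNorm`). Plumbing definition.
[cite: WangLiuLiKubicaGu2026, §III.A Definition III.1 (arXiv:2601.15446 p. 4: total check weight `wt(C) = Σ_i |S_i|`)] -/
def supp₂ (x : Q → ZMod 2) : Finset Q := univ.filter fun q => x q ≠ 0

omit [DecidableEq Q] in
/-- Membership in the support. [cite: WangLiuLiKubicaGu2026, §III.A Definition III.1 (arXiv:2601.15446 p. 4)] -/
@[simp] theorem mem_supp₂ {x : Q → ZMod 2} {q : Q} : q ∈ supp₂ x ↔ x q ≠ 0 := by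
  simp [supp₂]

omit [DecidableEq Q] in
/-- `#supp = hammingNorm`. [cite: WangLiuLiKubicaGu2026, §III.A Definition III.1 (arXiv:2601.15446 p. 4)] -/
theorem card_supp₂ (x : Q → ZMod 2) : #(supp₂ x) = hammingNorm x := rfl

omit [DecidableEq Q] in
/-- The support is empty iff the vector is zero. [cite: WangLiuLiKubicaGu2026, §III.A Definition III.1 (arXiv:2601.15446 p. 4)] -/
theorem supp₂_eq_empty_iff {x : Q → ZMod 2} : supp₂ x = ∅ ↔ x = 0 := by
  rw [← Finset.card_eq_zero, card_supp₂, hammingNorm_eq_zero]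

/-- The indicator vector of a set of qubits (the `X`- or `Z`-type Pauli operator on that set). Plumbing definition.
[cite: WangLiuLiKubicaGu2026, §III.A (arXiv:2601.15446 p. 4: checks `X_1X_2`, `Z_1Z_2`, …)] -/
def ind₂ (A : Finset Q) : Q → ZMod 2 := fun q => if q ∈ A then 1 else 0

omit [Fintype Q] in
/-- Value of the indicator. [cite: WangLiuLiKubicaGu2026, §III.A (arXiv:2601.15446 p. 4)] -/
@[simp] theorem ind₂_apply (A : Finset Q) (q : Q) : ind₂ A q = if q ∈ A then 1 else 0 := rfl

/-- The support of an indicator. [cite: WangLiuLiKubicaGu2026, §III.A (arXiv:2601.15446 p. 4)] -/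
@[simp] theorem supp₂_ind₂ (A : Finset Q) : supp₂ (ind₂ A) = A := by
  ext q; by_cases hq : q ∈ A <;> simp [hq]

/-- The weight of an indicator. [cite: WangLiuLiKubicaGu2026, §III.A (arXiv:2601.15446 p. 4)] -/
theorem hammingNorm_ind₂ (A : Finset Q) : hammingNorm (ind₂ A) = #A := by
  rw [← card_supp₂, supp₂_ind₂]

/-- A binary vector is the indicator of its support. [cite: WangLiuLiKubicaGu2026, §III.A (arXiv:2601.15446 p. 4)] -/
theorem ind₂_supp₂ (x : Q → ZMod 2) : ind₂ (supp₂ x) = x := by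
  funext q
  by_cases hq : x q = 0
  · simp [hq]
  · simp [z2_eq_one_of_ne_zero hq]

/-- Over `𝔽₂` the dot product is the parity of the common support. [cite: WangLiuLiKubicaGu2026, §III.A (arXiv:2601.15446 p. 4: coinciding / mismatching checks, commutation)] -/
theorem dotProduct_eq_card_inter (x y : Q → ZMod 2) : x ⬝ᵥ y = (#(supp₂ x ∩ supp₂ y) : ZMod 2) := by
  rw [dotProduct, Finset.card_eq_sum_ones, Nat.cast_sum, ← Finset.sum_subset (Finset.subset_univ (supp₂ x ∩ supp₂ y))]
  · refine sum_congr rfl fun q hq => ?_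
    rw [mem_inter, mem_supp₂, mem_supp₂] at hq
    rw [z2_eq_one_of_ne_zero hq.1, z2_eq_one_of_ne_zero hq.2]; simp
  · intro q _ hq
    rw [mem_inter, mem_supp₂, mem_supp₂, not_and_or, not_not, not_not] at hq
    rcases hq with hq | hq <;> simp [hq]

/-- `x ⬝ y = 0` over `𝔽₂` iff the supports meet in an even number of qubits (the operators `X(x)`, `Z(y)` commute).
[cite: WangLiuLiKubicaGu2026, §III.A (arXiv:2601.15446 p. 4: commutation of checks)] -/
theorem dotProduct_eq_zero_iff_even (x y : Q → ZMod 2) : x ⬝ᵥ y = 0 ↔ Even #(supp₂ x ∩ supp₂ y) := by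
  rw [dotProduct_eq_card_inter, ZMod.natCast_eq_zero_iff_even]

/-- The support of a sum is the symmetric difference: `#supp(x+y) + 2 #(supp x ∩ supp y) = #supp x + #supp y`.
[cite: WangLiuLiKubicaGu2026, §III.A proof of Lemma III.3 (2) (arXiv:2601.15446 p. 5: replacing a check by the product of two checks lowers the total weight)] -/
theorem card_supp₂_add (x y : Q → ZMod 2) : #(supp₂ (x + y)) + 2 * #(supp₂ x ∩ supp₂ y) = #(supp₂ x) + #(supp₂ y) := by
  have hset : supp₂ (x + y) = (supp₂ x ∪ supp₂ y) \ (supp₂ x ∩ supp₂ y) := by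
    ext q
    simp only [mem_supp₂, Pi.add_apply, mem_sdiff, mem_union, mem_inter, not_and_or, not_not]
    by_cases hx : x q = 0
    · simp [hx]
    · by_cases hy : y q = 0
      · simp [hx, hy]
      · rw [z2_eq_one_of_ne_zero hx, z2_eq_one_of_ne_zero hy]; decide
  rw [hset, card_sdiff_of_subset (inter_subset_union), ← card_union_add_card_inter, two_mul]
  have : #(supp₂ x ∩ supp₂ y) ≤ #(supp₂ x ∪ supp₂ y) := card_le_card inter_subset_union
  omega

omit [DecidableEq Q] in
/-- Deleting coordinates does not increase the weight. [cite: WangLiuLiKubicaGu2026, §III.A (arXiv:2601.15446 p. 4, disentangled qubits)] -/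
theorem hammingNorm_comp_subtype_le (pr : Q → Prop) [DecidablePred pr] (w : Q → ZMod 2) :
    hammingNorm (fun p : Subtype pr => w p.1) ≤ hammingNorm w := by
  unfold hammingNorm
  have hsub : (univ.filter fun p : Subtype pr => w p.1 ≠ 0).map (Function.Embedding.subtype _) ⊆
      univ.filter fun i : Q => w i ≠ 0 := by
    intro i hi
    simp only [mem_map, mem_filter, mem_univ, true_and, Function.Embedding.coe_subtype] at hi
    obtain ⟨p, hp, rfl⟩ := hi
    exact mem_filter.2 ⟨mem_univ _, hp⟩
  exact le_trans (card_map _).ge (card_le_card hsub)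

omit [Fintype Q] [DecidableEq Q] in
/-- `cᵀH = Σ_r c_r H_r`. [folklore] -/
private theorem vecMul_eq_sum_smul {R : Type*} [Fintype R] (c : R → ZMod 2) (H : Matrix R Q (ZMod 2)) :
    c ᵥ* H = ∑ r, c r • H r := by
  funext p; simp [Matrix.vecMul, dotProduct, Finset.sum_apply]

omit [Fintype Q] [DecidableEq Q] in
/-- A row space is contained in any subspace containing the rows. [cite: NielsenChuang2010, §10.4.1 p. 449 (C^⊥ has generator matrix Hᵀ)] -/
theorem rowSpace_le_of_forall_row_mem {R : Type*} [Fintype R] {H : Matrix R Q (ZMod 2)} {W : Submodule (ZMod 2) (Q → ZMod 2)}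
    (h : ∀ r, H r ∈ W) : rowSpace H ≤ W := by
  intro w hw
  obtain ⟨c, rfl⟩ := (mem_rowSpace_iff H w).1 hw
  rw [vecMul_eq_sum_smul]
  exact Submodule.sum_mem _ fun r _ => Submodule.smul_mem _ _ (h r)

omit [DecidableEq Q] in
/-- The code `ker H` is determined by the row space: `v ∈ ker H ↔ v ⊥ rs H`. [cite: NielsenChuang2010, §10.4.1 p. 449 (C^⊥ has generator matrix Hᵀ; "all y orthogonal to all the codewords")] -/
theorem mem_pcCode_iff_forall_rowSpace {R : Type*} [Fintype R] (H : Matrix R Q (ZMod 2)) (v : Q → ZMod 2) :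
    v ∈ pcCode H ↔ ∀ w ∈ rowSpace H, v ⬝ᵥ w = 0 := by
  constructor
  · intro hv w hw
    exact dotProduct_eq_zero_of_mem_rowSpace hw hv
  · intro h
    rw [mem_pcCode_iff]
    funext r
    rw [Matrix.mulVec, Pi.zero_apply, dotProduct_comm]
    exact h _ (row_mem_rowSpace H r)

omit [DecidableEq Q] in
/-- Matrices with the same row space have the same code. [cite: NielsenChuang2010, §10.4.1 p. 449 (C^⊥ has generator matrix Hᵀ)] -/
theorem pcCode_eq_of_rowSpace_eq {R R' : Type*} [Fintype R] [Fintype R'] {H : Matrix R Q (ZMod 2)} {H' : Matrix R' Q (ZMod 2)}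
    (h : rowSpace H = rowSpace H') : pcCode H = pcCode H' := by
  ext v; rw [mem_pcCode_iff_forall_rowSpace, mem_pcCode_iff_forall_rowSpace, h]

omit [Fintype RX] [Fintype RZ] [DecidableEq Q] in
/-- Rows of `H^X` and `H^Z` commute: `x_r ⬝ z_s = 0`. [cite: WangLiuLiKubicaGu2026, §III.A (arXiv:2601.15446 p. 4: commutation of checks)] -/
theorem HX_dotProduct_HZ (C : CSSCode RX RZ Q) (r : RX) (s : RZ) : C.HX r ⬝ᵥ C.HZ s = 0 := by
  have := congrFun (congrFun C.comm r) s
  rwa [Matrix.mul_apply', Matrix.zero_apply] at this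

omit [Fintype RX] [Fintype RZ] in
/-- Supports of an `X`-check and a `Z`-check meet evenly. [cite: WangLiuLiKubicaGu2026, §III.A (arXiv:2601.15446 p. 4: commutation of checks)] -/
theorem even_card_inter_HX_HZ (C : CSSCode RX RZ Q) (r : RX) (s : RZ) : Even #(supp₂ (C.HX r) ∩ supp₂ (C.HZ s)) :=
  (dotProduct_eq_zero_iff_even _ _).1 (C.HX_dotProduct_HZ r s)

end Supports

section Exchange

variable [DecidableEq RX]

/-- **Replace the `X`-check `r` by an `X`-stabilizer `v`** (e.g. by its product with another check). The result is a
CSS code (all rows stay in `rs H^X ⊆ ker H^Z`). [cite: WangLiuLiKubicaGu2026, §III.A proof of Lemma III.3 (2) (arXiv:2601.15446 p. 5: «we could replace one of them by the product of the checks to obtain a smaller total check weight»)] -/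
def exchX (C : CSSCode RX RZ Q) (r : RX) (v : Q → ZMod 2) (hv : v ∈ C.rowSpX) : CSSCode RX RZ Q :=
  ofMatrices (C.HX.updateRow r v) C.HZ (by
    ext r' s
    rw [Matrix.mul_apply', Matrix.zero_apply]
    by_cases h : r' = r
    · subst h
      rw [Matrix.updateRow_self]
      have hz : C.HZ *ᵥ v = 0 := C.rowSpX_le_kerZ hv
      have := congrFun hz s
      rwa [Matrix.mulVec, Pi.zero_apply, dotProduct_comm] at this
    · rw [Matrix.updateRow_ne h]; exact C.HX_dotProduct_HZ r' s)

omit [Fintype RZ] [DecidableEq Q] in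
/-- `Z`-checks are unchanged. [cite: WangLiuLiKubicaGu2026, §III.A proof of Lemma III.3 (2) (arXiv:2601.15446 p. 5)] -/
@[simp] theorem exchX_HZ (C : CSSCode RX RZ Q) (r : RX) (v : Q → ZMod 2) (hv : v ∈ C.rowSpX) : (C.exchX r v hv).HZ = C.HZ := rfl

omit [Fintype RZ] [DecidableEq Q] in
/-- The new `X`-check matrix. [cite: WangLiuLiKubicaGu2026, §III.A proof of Lemma III.3 (2) (arXiv:2601.15446 p. 5)] -/
@[simp] theorem exchX_HX (C : CSSCode RX RZ Q) (r : RX) (v : Q → ZMod 2) (hv : v ∈ C.rowSpX) :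
    (C.exchX r v hv).HX = C.HX.updateRow r v := rfl

omit [Fintype RZ] [DecidableEq Q] in
/-- The exchange does not enlarge the `X`-stabilizer span. [cite: WangLiuLiKubicaGu2026, §III.A proof of Lemma III.3 (2) (arXiv:2601.15446 p. 5)] -/
theorem rowSpX_exchX_le (C : CSSCode RX RZ Q) (r : RX) (v : Q → ZMod 2) (hv : v ∈ C.rowSpX) :
    (C.exchX r v hv).rowSpX ≤ C.rowSpX := by
  refine rowSpace_le_of_forall_row_mem fun r' => ?_
  rw [exchX_HX]
  by_cases h : r' = r
  · subst h; rwa [Matrix.updateRow_self]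
  · rw [Matrix.updateRow_ne h]; exact row_mem_rowSpace C.HX r'

omit [Fintype RZ] [DecidableEq Q] in
/-- **Same stabilizer group** when the old check is recovered: if `x_r + v` is a combination of the OTHER `X`-checks then
`rs (H^X with row r := v) = rs H^X`. [cite: WangLiuLiKubicaGu2026, §III.A proof of Lemma III.3 (2) (arXiv:2601.15446 p. 5)] -/
theorem rowSpX_exchX_eq (C : CSSCode RX RZ Q) (r : RX) (v : Q → ZMod 2) (hv : v ∈ C.rowSpX)
    (hr : C.HX r + v ∈ Submodule.span (ZMod 2) (C.HX '' {r' | r' ≠ r})) : (C.exchX r v hv).rowSpX = C.rowSpX := by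
  refine le_antisymm (C.rowSpX_exchX_le r v hv) (rowSpace_le_of_forall_row_mem fun r' => ?_)
  have hothers : Submodule.span (ZMod 2) (C.HX '' {r' | r' ≠ r}) ≤ (C.exchX r v hv).rowSpX := by
    refine Submodule.span_le.2 ?_
    rintro _ ⟨r', hr', rfl⟩
    have := row_mem_rowSpace (C.exchX r v hv).HX r'
    rwa [exchX_HX, Matrix.updateRow_ne hr'] at this
  by_cases h : r' = r
  · subst h
    have hvmem : v ∈ (C.exchX r' v hv).rowSpX := by
      have := row_mem_rowSpace (C.exchX r' v hv).HX r'
      rwa [exchX_HX, Matrix.updateRow_self] at this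
    have : C.HX r' = (C.HX r' + v) + v := by
      funext q; simp only [Pi.add_apply]; rw [add_assoc, CharTwo.add_self_eq_zero, add_zero]
    rw [this]
    exact Submodule.add_mem _ (hothers hr) hvmem
  · exact hothers (Submodule.subset_span ⟨r', h, rfl⟩)

omit [Fintype RZ] [DecidableEq Q] in
/-- Hence the same `d^X`. [cite: WangLiuLiKubicaGu2026, §III.A proof of Lemma III.3 (2) (arXiv:2601.15446 p. 5)] -/
theorem dX_exchX (C : CSSCode RX RZ Q) (r : RX) (v : Q → ZMod 2) (hv : v ∈ C.rowSpX)
    (hr : C.HX r + v ∈ Submodule.span (ZMod 2) (C.HX '' {r' | r' ≠ r})) : (C.exchX r v hv).dX = C.dX := by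
  unfold dX
  rw [show (C.exchX r v hv).kerZ = C.kerZ from rfl, rowSpX_exchX_eq C r v hv hr]

omit [DecidableEq Q] in
/-- … the same `d^Z` (`ker H^X` depends on `rs H^X` only). [cite: WangLiuLiKubicaGu2026, §III.A proof of Lemma III.3 (2) (arXiv:2601.15446 p. 5)] -/
theorem dZ_exchX (C : CSSCode RX RZ Q) (r : RX) (v : Q → ZMod 2) (hv : v ∈ C.rowSpX)
    (hr : C.HX r + v ∈ Submodule.span (ZMod 2) (C.HX '' {r' | r' ≠ r})) : (C.exchX r v hv).dZ = C.dZ := by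
  rw [dZ, dZ]; unfold dX
  rw [show (C.exchX r v hv).swap.kerZ = pcCode (C.HX.updateRow r v) from rfl,
    show C.swap.kerZ = pcCode C.HX from rfl, show (C.exchX r v hv).swap.rowSpX = C.rowSpZ from rfl,
    show C.swap.rowSpX = C.rowSpZ from rfl,
    pcCode_eq_of_rowSpace_eq (H := C.HX.updateRow r v) (H' := C.HX) (rowSpX_exchX_eq C r v hv hr)]

omit [Fintype RZ] [DecidableEq Q] in
/-- … and the same `k`. [cite: WangLiuLiKubicaGu2026, §III.A proof of Lemma III.3 (2) (arXiv:2601.15446 p. 5)] -/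
theorem k_exchX (C : CSSCode RX RZ Q) (r : RX) (v : Q → ZMod 2) (hv : v ∈ C.rowSpX)
    (hr : C.HX r + v ∈ Submodule.span (ZMod 2) (C.HX '' {r' | r' ≠ r})) : (C.exchX r v hv).k = C.k := by
  unfold k
  rw [show (C.exchX r v hv).kerZ = C.kerZ from rfl, rowSpX_exchX_eq C r v hv hr]

end Exchange

/-! ## Part B.2  The descent: total check weight, the induction hypothesis, and the reduction steps -/

section Descent

/-- **Check weight at most three** (both check matrices). [cite: WangLiuLiKubicaGu2026, §III.A (arXiv:2601.15446 p. 4: «stabilizer code with check weight 3»)] -/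
def CheckWeightLE (C : CSSCode RX RZ Q) (w : ℕ) : Prop :=
  (∀ r, hammingNorm (C.HX r) ≤ w) ∧ ∀ s, hammingNorm (C.HZ s) ≤ w

/-- The descent parameter: number of qubits plus the **total check weight** `wt(C) = Σ_i |S_i|` of Definition III.1
(the printed proof minimises `n` first and `wt` second; any reduction below lowers `n + wt`).
[cite: WangLiuLiKubicaGu2026, §III.A Definitions III.1–III.2 (arXiv:2601.15446 p. 4)] -/
def meas (C : CSSCode RX RZ Q) : ℕ :=
  Fintype.card Q + (∑ r, hammingNorm (C.HX r) + ∑ s, hammingNorm (C.HZ s))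

omit [DecidableEq Q] in
/-- The parameter is symmetric under `X ↔ Z`. [cite: WangLiuLiKubicaGu2026, §III.A Definitions III.1–III.2 (arXiv:2601.15446 p. 4)] -/
@[simp] theorem meas_swap (C : CSSCode RX RZ Q) : meas C.swap = meas C := by
  unfold meas; simp only [swap_HX, swap_HZ]; rw [add_comm (∑ s, hammingNorm (C.HZ s))]

omit [Fintype RX] [Fintype RZ] [DecidableEq Q] in
/-- Check weight is symmetric under `X ↔ Z`. [cite: WangLiuLiKubicaGu2026, §III.A (arXiv:2601.15446 p. 4)] -/
theorem checkWeightLE_swap {C : CSSCode RX RZ Q} {w : ℕ} (h : CheckWeightLE C w) : CheckWeightLE C.swap w :=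
  ⟨h.2, h.1⟩

universe u v w in
/-- The induction hypothesis of the descent at `C`: the theorem holds for every CSS code (on types in the same universes)
with a smaller parameter. Plumbing definition. [cite: WangLiuLiKubicaGu2026, §III.A Definition III.2 (arXiv:2601.15446 p. 4: minimal code)] -/
def DescentIH {RX : Type u} {RZ : Type v} {Q : Type w} [Fintype RX] [Fintype RZ] [Fintype Q] (C : CSSCode RX RZ Q) : Prop :=
  ∀ {RX' : Type u} {RZ' : Type v} {Q' : Type w} [Fintype RX'] [Fintype RZ'] [Fintype Q'] [DecidableEq Q']
    (C' : CSSCode RX' RZ' Q'), meas C' < meas C → CheckWeightLE C' 3 → 0 < C'.k → min C'.dX C'.dZ ≤ 2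

omit [DecidableEq Q] in
/-- The induction hypothesis passes to the `X ↔ Z` exchange (swap the smaller code back). [cite: WangLiuLiKubicaGu2026, §III.A (arXiv:2601.15446 p. 5: «the case of X checks is handled similarly»)] -/
theorem DescentIH.swap {C : CSSCode RX RZ Q} (ih : DescentIH C) : DescentIH C.swap := by
  intro RX' RZ' Q' _ _ _ _ C' hm hw hk
  have h := ih C'.swap (by rw [meas_swap, ← meas_swap C]; exact hm) (checkWeightLE_swap hw) (by rwa [k_swap])
  rwa [dX_swap, dZ_swap, min_comm] at h

omit [DecidableEq Q] in
/-- Step 0: an explicit `X`-logical of weight `≤ 2` settles the claim. [cite: WangLiuLiKubicaGu2026, §III.A proof of Lemma III.3 (1) (arXiv:2601.15446 p. 5: «Z_1 is a logical operator of the code, which must be a stabilizer due to the distance»)] -/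
theorem step_logicalX (C : CSSCode RX RZ Q) {v : Q → ZMod 2} (hv : C.HZ *ᵥ v = 0) (hv' : v ∉ C.rowSpX)
    (h2 : hammingNorm v ≤ 2) : min C.dX C.dZ ≤ 2 :=
  (min_le_left _ _).trans ((C.dX_le_hammingNorm hv hv').trans h2)

omit [DecidableEq Q] in
/-- Step 0 (`Z` side). [cite: WangLiuLiKubicaGu2026, §III.A proof of Lemma III.3 (1) (arXiv:2601.15446 p. 5)] -/
theorem step_logicalZ (C : CSSCode RX RZ Q) {v : Q → ZMod 2} (hv : C.HX *ᵥ v = 0) (hv' : v ∉ C.rowSpZ)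
    (h2 : hammingNorm v ≤ 2) : min C.dX C.dZ ≤ 2 :=
  (min_le_right _ _).trans ((C.dZ_le_hammingNorm hv hv').trans h2)

/-- Step 1: a weight-one `X`-stabilizer `X_q` — puncture at `q` (CRSS Thm. 6 (e), `CSSPuncturing.lean`) and use the
induction hypothesis. [cite: WangLiuLiKubicaGu2026, §III.A proof of Lemma III.3 (1) (arXiv:2601.15446 p. 5: «qubit 1 is disentangled, a contradiction of minimality»)] -/
theorem step_punctureX (C : CSSCode RX RZ Q) (hw : CheckWeightLE C 3) (hk : 0 < C.k) (ih : DescentIH C) (q : Q)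
    (h : Pi.single q 1 ∈ C.rowSpX) : min C.dX C.dZ ≤ 2 := by
  obtain ⟨hk', hdX, hdZ⟩ := C.puncture_params q h hk
  have hm : meas (C.puncture q h) < meas C := by
    unfold meas
    have hc : Fintype.card {p : Q // p ≠ q} + 1 = Fintype.card Q := by
      rw [show Fintype.card {p : Q // p ≠ q} = Fintype.card {p : Q // ¬ (p = q)} from rfl, Fintype.card_subtype_compl,
        Fintype.card_subtype_eq]
      have : 1 ≤ Fintype.card Q := Fintype.card_pos_iff.2 ⟨q⟩
      omega
    have h1 : ∑ r, hammingNorm ((C.puncture q h).HX r) ≤ ∑ r, hammingNorm (C.HX r) :=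
      sum_le_sum fun r _ => hammingNorm_comp_subtype_le (· ≠ q) (C.HX r)
    have h2 : ∑ s, hammingNorm ((C.puncture q h).HZ s) ≤ ∑ s, hammingNorm (C.HZ s) :=
      sum_le_sum fun s _ => hammingNorm_comp_subtype_le (· ≠ q) (C.HZ s)
    omega
  have hw' : CheckWeightLE (C.puncture q h) 3 :=
    ⟨fun r => (hammingNorm_comp_subtype_le (· ≠ q) (C.HX r)).trans (hw.1 r),
      fun s => (hammingNorm_comp_subtype_le (· ≠ q) (C.HZ s)).trans (hw.2 s)⟩
  have := ih (C.puncture q h) hm hw' (hk'.symm ▸ hk)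
  rcases min_le_iff.1 this with h' | h'
  · exact min_le_iff.2 (Or.inl (hdX.trans h'))
  · exact min_le_iff.2 (Or.inr (hdZ.trans h'))

/-- Step 1 (`Z` side): a weight-one `Z`-stabilizer `Z_q`. [cite: WangLiuLiKubicaGu2026, §III.A proof of Lemma III.3 (1) (arXiv:2601.15446 p. 5)] -/
theorem step_punctureZ (C : CSSCode RX RZ Q) (hw : CheckWeightLE C 3) (hk : 0 < C.k) (ih : DescentIH C) (q : Q)
    (h : Pi.single q 1 ∈ C.rowSpZ) : min C.dX C.dZ ≤ 2 := by
  have := step_punctureX C.swap (checkWeightLE_swap hw) (by rwa [k_swap]) ih.swap q h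
  rwa [dX_swap, dZ_swap, min_comm] at this

/-- Step 2: **replace an `X`-check by a strictly lighter stabilizer** from which it is recovered (product of two checks
sharing `≥ 2` qubits; a redundant check by `0`; a weight-3 check by a weight-2 stabilizer it spans) and use the
induction hypothesis — the code, hence `k, d^X, d^Z`, is unchanged. [cite: WangLiuLiKubicaGu2026, §III.A proof of Lemma III.3 (2) and of (4) (arXiv:2601.15446 p. 5: «replace one of them by the product»; «it cannot be a product of weight-3 checks by minimality»)] -/
theorem step_exchX [DecidableEq RX] (C : CSSCode RX RZ Q) (hw : CheckWeightLE C 3) (hk : 0 < C.k) (ih : DescentIH C)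
    (r : RX) (v : Q → ZMod 2) (hv : v ∈ C.rowSpX) (hlt : hammingNorm v < hammingNorm (C.HX r))
    (hr : C.HX r + v ∈ Submodule.span (ZMod 2) (C.HX '' {r' | r' ≠ r})) : min C.dX C.dZ ≤ 2 := by
  set C' := C.exchX r v hv
  have hm : meas C' < meas C := by
    unfold meas
    have h1 : ∑ r', hammingNorm (C'.HX r') + hammingNorm (C.HX r) = ∑ r', hammingNorm (C.HX r') + hammingNorm v := by
      rw [← Finset.add_sum_erase _ _ (mem_univ r), ← Finset.add_sum_erase _ (fun r' => hammingNorm (C.HX r')) (mem_univ r)]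
      have : ∑ r' ∈ univ.erase r, hammingNorm (C'.HX r') = ∑ r' ∈ univ.erase r, hammingNorm (C.HX r') :=
        sum_congr rfl fun r' hr' => by rw [show C'.HX = C.HX.updateRow r v from rfl, Matrix.updateRow_ne (ne_of_mem_erase hr')]
      rw [this, show C'.HX r = v from Matrix.updateRow_self]
      ring
    rw [show C'.HZ = C.HZ from rfl]
    omega
  have hw' : CheckWeightLE C' 3 := by
    refine ⟨fun r' => ?_, hw.2⟩
    rw [show C'.HX = C.HX.updateRow r v from rfl]
    by_cases h : r' = r
    · subst h; rw [Matrix.updateRow_self]; exact (hlt.le.trans (hw.1 r'))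
    · rw [Matrix.updateRow_ne h]; exact hw.1 r'
  have := ih C' hm hw' (by rw [k_exchX C r v hv hr]; exact hk)
  rwa [dX_exchX C r v hv hr, dZ_exchX C r v hv hr] at this

/-- Step 2 (`Z` side). [cite: WangLiuLiKubicaGu2026, §III.A proof of Lemma III.3 (2) (arXiv:2601.15446 p. 5: «the case of X checks is handled similarly»)] -/
theorem step_exchZ [DecidableEq RZ] (C : CSSCode RX RZ Q) (hw : CheckWeightLE C 3) (hk : 0 < C.k) (ih : DescentIH C)
    (s : RZ) (v : Q → ZMod 2) (hv : v ∈ C.rowSpZ) (hlt : hammingNorm v < hammingNorm (C.HZ s))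
    (hr : C.HZ s + v ∈ Submodule.span (ZMod 2) (C.HZ '' {s' | s' ≠ s})) : min C.dX C.dZ ≤ 2 := by
  have := step_exchX C.swap (checkWeightLE_swap hw) (by rwa [k_swap]) ih.swap s v hv hlt hr
  rwa [dX_swap, dZ_swap, min_comm] at this

/-- Step 3: **puncture a disentangled set** `P ≠ ∅` (Part A) and use the induction hypothesis.
[cite: WangLiuLiKubicaGu2026, §III.A (arXiv:2601.15446 p. 4: «there would be a smaller code with the same dimension and distance»)] -/
theorem step_punctureSet (C : CSSCode RX RZ Q) (hw : CheckWeightLE C 3) (hk : 0 < C.k) (ih : DescentIH C)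
    (P : Finset Q) (hP : P.Nonempty) (hX : ∀ r, maskOn P (C.HX r) ∈ C.rowSpX) (hZ : ∀ s, maskOn P (C.HZ s) ∈ C.rowSpZ)
    (hMX : ∀ u : Q → ZMod 2, (∀ p ∉ P, u p = 0) → C.HZ *ᵥ u = 0 → u ∈ C.rowSpX) : min C.dX C.dZ ≤ 2 := by
  set C' := C.punctureSet P hX hZ
  have hk' : 0 < C'.k := C.k_punctureSet_pos P hX hZ hMX hk
  have hm : meas C' < meas C := by
    unfold meas
    have hc := card_punctureSet P
    have hP' : 1 ≤ #P := card_pos.2 hP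
    have hPQ : #P ≤ Fintype.card Q := card_le_univ P
    have h1 : ∑ r, hammingNorm (C'.HX r) ≤ ∑ r, hammingNorm (C.HX r) :=
      sum_le_sum fun r _ => hammingNorm_comp_subtype_le (· ∉ P) (C.HX r)
    have h2 : ∑ s, hammingNorm (C'.HZ s) ≤ ∑ s, hammingNorm (C.HZ s) :=
      sum_le_sum fun s _ => hammingNorm_comp_subtype_le (· ∉ P) (C.HZ s)
    omega
  have hw' : CheckWeightLE C' 3 :=
    ⟨fun r => (hammingNorm_comp_subtype_le (· ∉ P) (C.HX r)).trans (hw.1 r),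
      fun s => (hammingNorm_comp_subtype_le (· ∉ P) (C.HZ s)).trans (hw.2 s)⟩
  have := ih C' hm hw' hk'
  rcases min_le_iff.1 this with h' | h'
  · exact min_le_iff.2 (Or.inl ((C.dX_le_dX_punctureSet P hX hZ hk').trans h'))
  · exact min_le_iff.2 (Or.inr ((C.dZ_le_dZ_punctureSet P hX hZ hk').trans h'))

end Descent


/-! ## Part B.3  The structure of a code with no reduction left (Lemma III.3) -/

section Analysis

variable [DecidableEq RX] [DecidableEq RZ]

/-- The number of `X`-checks acting on qubit `q`. Plumbing definition. [cite: WangLiuLiKubicaGu2026, §III.A Lemma III.3 (1), (3) (arXiv:2601.15446 pp. 4–5)] -/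
def degX (C : CSSCode RX RZ Q) (q : Q) : ℕ := #(univ.filter fun r => C.HX r q ≠ 0)

/-- The nonzero `X`-checks. Plumbing definition. [cite: WangLiuLiKubicaGu2026, §III.A proof of Theorem III.4 (arXiv:2601.15446 p. 5: `r = r₂ + r₃`)] -/
def nzX (C : CSSCode RX RZ Q) : Finset RX := univ.filter fun r => C.HX r ≠ 0

/-- The number of OTHER `X`-checks intersecting the `X`-check `r` (its «coinciding» partners). Plumbing definition.
[cite: WangLiuLiKubicaGu2026, §III.A Lemma III.3 (4) (arXiv:2601.15446 p. 5: pairs of intersecting checks of the same type)] -/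
def cX (C : CSSCode RX RZ Q) (r : RX) : ℕ := #(univ.filter fun r' => r' ≠ r ∧ (supp₂ (C.HX r) ∩ supp₂ (C.HX r')).Nonempty)

omit [Fintype RX] [Fintype RZ] [DecidableEq RX] [DecidableEq RZ] in
/-- `ind A ⬝ x = Σ_{q ∈ A} x_q`. [cite: WangLiuLiKubicaGu2026, §III.A (arXiv:2601.15446 p. 4: commutation of checks)] -/
theorem ind₂_dotProduct (A : Finset Q) (x : Q → ZMod 2) : ind₂ A ⬝ᵥ x = ∑ q ∈ A, x q := by
  rw [dotProduct, ← sum_subset (subset_univ A)]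
  · exact sum_congr rfl fun q hq => by simp [hq]
  · intro q _ hq; simp [hq]

omit [Fintype RX] [Fintype RZ] [DecidableEq RX] [DecidableEq RZ] in
/-- `x ⬝ ind A = Σ_{q ∈ A} x_q`. [cite: WangLiuLiKubicaGu2026, §III.A (arXiv:2601.15446 p. 4: commutation of checks)] -/
theorem dotProduct_ind₂ (x : Q → ZMod 2) (A : Finset Q) : x ⬝ᵥ ind₂ A = ∑ q ∈ A, x q := by
  rw [dotProduct_comm, ind₂_dotProduct]

omit [Fintype RX] [Fintype RZ] [DecidableEq RX] [DecidableEq RZ] in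
/-- In characteristic two, `a + b = 0 ↔ a = b`. [folklore] -/
private theorem z2_add_eq_zero_iff {a b : ZMod 2} : a + b = 0 ↔ a = b := by
  rw [← CharTwo.sub_eq_add, sub_eq_zero]

omit [Fintype RX] [Fintype RZ] [Fintype Q] [DecidableEq RX] [DecidableEq RZ] in
/-- A vector supported on `{a, b}` with `u_a = u_b` is a multiple of `X_aX_b`: it lies in any subspace containing
`ind {a,b}`. [cite: WangLiuLiKubicaGu2026, §III.A proof of Lemma III.3 (4) (arXiv:2601.15446 p. 5: «qubits i and j would be disentangled»)] -/
theorem mem_of_pair {W : Submodule (ZMod 2) (Q → ZMod 2)} {a b : Q} (hD : ind₂ {a, b} ∈ W) (u : Q → ZMod 2)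
    (hu0 : ∀ p, p ∉ ({a, b} : Finset Q) → u p = 0) (hsum : u a + u b = 0) : u ∈ W := by
  have : u = u a • ind₂ {a, b} := by
    funext p
    by_cases hp : p ∈ ({a, b} : Finset Q)
    · rcases mem_insert.1 hp with rfl | hp
      · simp
      · rw [mem_singleton] at hp; subst hp
        simp [z2_add_eq_zero_iff.1 hsum]
    · simp [hp, hu0 p hp]
  rw [this]; exact W.smul_mem _ hD

omit [Fintype RX] [Fintype RZ] [Fintype Q] [DecidableEq RX] [DecidableEq RZ] in
/-- A vector supported on `{a, b, c}` with `u_a + u_b + u_c = 0` lies in any subspace containing `ind {a,b}` and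
`ind {a,c}` (it is `u_b·X_aX_b + u_c·X_aX_c`). [cite: WangLiuLiKubicaGu2026, §III.A proof of Lemma III.3 (4) (arXiv:2601.15446 p. 5: «three independent stabilizers supported on the three qubits i, j, and k, which disentangles them»)] -/
theorem mem_of_triple {W : Submodule (ZMod 2) (Q → ZMod 2)} {a b c : Q} (hab : a ≠ b) (hac : a ≠ c) (hbc : b ≠ c)
    (hAB : ind₂ {a, b} ∈ W) (hAC : ind₂ {a, c} ∈ W) (u : Q → ZMod 2)
    (hu0 : ∀ p, p ∉ ({a, b, c} : Finset Q) → u p = 0) (hsum : u a + u b + u c = 0) : u ∈ W := by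
  have hua : u a = u b + u c := by
    have : u a = -(u b + u c) := by rw [eq_neg_iff_add_eq_zero, ← add_assoc, hsum]
    rw [this, CharTwo.neg_eq]
  have : u = u b • ind₂ {a, b} + u c • ind₂ {a, c} := by
    funext p
    by_cases hp : p ∈ ({a, b, c} : Finset Q)
    · simp only [mem_insert, mem_singleton] at hp
      rcases hp with rfl | rfl | rfl
      · simp [hua]
      · simp [hab.symm, hbc]
      · simp [hac.symm, Ne.symm hbc]
    · have hpa : p ≠ a := fun h => hp (by simp [h])
      have hpb : p ≠ b := fun h => hp (by simp [h])
      have hpc : p ≠ c := fun h => hp (by simp [h])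
      simp [hpa, hpb, hpc, hu0 p hp]
  rw [this]; exact W.add_mem (W.smul_mem _ hAB) (W.smul_mem _ hAC)

omit [Fintype RX] [Fintype RZ] [DecidableEq RX] [DecidableEq RZ] in
/-- A weight-one vector is a unit vector `e_q`. [cite: WangLiuLiKubicaGu2026, §III.A proof of Lemma III.3 (1) (arXiv:2601.15446 p. 5)] -/
theorem eq_single_of_hammingNorm_eq_one {x : Q → ZMod 2} (h : hammingNorm x = 1) : ∃ q, x = Pi.single q 1 := by
  rw [← card_supp₂, card_eq_one] at h
  obtain ⟨q, hq⟩ := h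
  refine ⟨q, ?_⟩
  rw [← ind₂_supp₂ x, hq]
  funext p; by_cases hp : p = q <;> simp [hp]

omit [Fintype RX] [Fintype RZ] [DecidableEq RX] [DecidableEq RZ] in
/-- `hammingNorm (e_q) = 1`. [folklore] -/
private theorem hammingNorm_single_one (q : Q) : hammingNorm (Pi.single q (1 : ZMod 2) : Q → ZMod 2) = 1 := by
  rw [← card_supp₂, card_eq_one]
  exact ⟨q, by ext p; by_cases hp : p = q <;> simp [hp]⟩

omit [Fintype RZ] [DecidableEq RX] [DecidableEq RZ] in
/-- **Lemma III.3, weights**: with no weight-one `X`-stabilizer, every nonzero `X`-check has weight `2` or `3`.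
[cite: WangLiuLiKubicaGu2026, §III.A proof of Theorem III.4 (arXiv:2601.15446 p. 5: `r₂` and `r₃` = the numbers of weight-2 and weight-3 checks)] -/
theorem A_weights (C : CSSCode RX RZ Q) (hw : CheckWeightLE C 3) (hX1 : ∀ q, (Pi.single q 1 : Q → ZMod 2) ∉ C.rowSpX)
    (r : RX) (hr : C.HX r ≠ 0) : hammingNorm (C.HX r) = 2 ∨ hammingNorm (C.HX r) = 3 := by
  have h0 : hammingNorm (C.HX r) ≠ 0 := by rwa [Ne, hammingNorm_eq_zero]
  have h1 : hammingNorm (C.HX r) ≠ 1 := by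
    intro h
    obtain ⟨q, hq⟩ := eq_single_of_hammingNorm_eq_one h
    exact hX1 q (hq ▸ row_mem_rowSpace C.HX r)
  have h3 := hw.1 r
  omega

omit [Fintype RZ] [DecidableEq RX] [DecidableEq RZ] in
/-- **Lemma III.3 (2)**: with no profitable exchange, two distinct `X`-checks share at most one qubit.
[cite: WangLiuLiKubicaGu2026, §III.A Lemma III.3 (2) (arXiv:2601.15446 pp. 4–5)] -/
theorem A_share (C : CSSCode RX RZ Q) (hw : CheckWeightLE C 3)
    (hXex : ∀ r v, v ∈ C.rowSpX → hammingNorm v < hammingNorm (C.HX r) →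
      C.HX r + v ∉ Submodule.span (ZMod 2) (C.HX '' {r' | r' ≠ r}))
    {r r' : RX} (hne : r ≠ r') : #(supp₂ (C.HX r) ∩ supp₂ (C.HX r')) ≤ 1 := by
  by_contra hlt
  rw [not_le] at hlt
  have hcard := card_supp₂_add (C.HX r) (C.HX r')
  have h3 : #(supp₂ (C.HX r')) ≤ 3 := by rw [card_supp₂]; exact hw.1 r'
  refine hXex r (C.HX r + C.HX r') (Submodule.add_mem _ (row_mem_rowSpace _ _) (row_mem_rowSpace _ _)) ?_ ?_
  · rw [← card_supp₂, ← card_supp₂]; omega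
  · have : C.HX r + (C.HX r + C.HX r') = C.HX r' := by
      rw [← add_assoc]; funext q; simp only [Pi.add_apply]; rw [CharTwo.add_self_eq_zero, zero_add]
    rw [this]
    exact Submodule.subset_span ⟨r', hne.symm, rfl⟩

omit [Fintype Q] [DecidableEq Q] [DecidableEq RX] [DecidableEq RZ] in
/-- `rs H = span (rows)`. [cite: NielsenChuang2010, §10.4.1 p. 449 (C^⊥ has generator matrix Hᵀ)] -/
private theorem rowSpace_eq_span_range {R : Type*} [Fintype R] (H : Matrix R Q (ZMod 2)) :
    rowSpace H = Submodule.span (ZMod 2) (Set.range H) :=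
  le_antisymm (rowSpace_le_of_forall_row_mem fun r => Submodule.subset_span ⟨r, rfl⟩)
    (Submodule.span_le.2 (by rintro _ ⟨r, rfl⟩; exact row_mem_rowSpace H r))

omit [Fintype RZ] [DecidableEq Q] [DecidableEq RX] [DecidableEq RZ] in
/-- **Independence of the checks**: with no redundant nonzero `X`-check, `rank H^X` is the number of nonzero
`X`-checks. [cite: WangLiuLiKubicaGu2026, §III.A (arXiv:2601.15446 p. 4: «the checks of any minimal code … are independent»; p. 5: «k = 0 as all checks are independent»)] -/
theorem A_rank (C : CSSCode RX RZ Q)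
    (hXex : ∀ r v, v ∈ C.rowSpX → hammingNorm v < hammingNorm (C.HX r) →
      C.HX r + v ∉ Submodule.span (ZMod 2) (C.HX '' {r' | r' ≠ r})) :
    C.HX.rank = #(nzX C) := by
  have hli : LinearIndepOn (ZMod 2) C.HX {r | C.HX r ≠ 0} := by
    rw [linearIndepOn_iff_notMem_span]
    intro r hr hmem
    have h0 : hammingNorm (0 : Q → ZMod 2) < hammingNorm (C.HX r) := by
      rw [hammingNorm_zero, pos_iff_ne_zero, Ne, hammingNorm_eq_zero]; exact hr
    refine hXex r 0 (Submodule.zero_mem _) h0 ?_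
    rw [add_zero]
    exact Submodule.span_mono (Set.image_mono fun r' hr' => hr'.2) hmem
  have hspan : Submodule.span (ZMod 2) (Set.range fun r : {r | C.HX r ≠ 0} => C.HX r.1) = rowSpace C.HX := by
    rw [rowSpace_eq_span_range]
    refine le_antisymm (Submodule.span_mono (by rintro _ ⟨r, rfl⟩; exact ⟨r.1, rfl⟩)) (Submodule.span_le.2 ?_)
    rintro _ ⟨r, rfl⟩
    by_cases hr : C.HX r = 0
    · rw [hr]; exact Submodule.zero_mem _
    · exact Submodule.subset_span ⟨⟨r, hr⟩, rfl⟩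
  rw [← finrank_rowSpace_eq_rank, ← hspan, finrank_span_eq_card hli, Fintype.card_subtype]
  rfl

omit [DecidableEq RX] [DecidableEq RZ] in
/-- **Lemma III.3 (1)**: with no weight-`≤ 2` `Z`-logical and no weight-one `Z`-stabilizer, every qubit is in some
`X`-check. [cite: WangLiuLiKubicaGu2026, §III.A Lemma III.3 (1) and proof (arXiv:2601.15446 pp. 4–5)] -/
theorem A_deg_pos (C : CSSCode RX RZ Q) (hZlog : ∀ v, C.HX *ᵥ v = 0 → hammingNorm v ≤ 2 → v ∈ C.rowSpZ)
    (hZ1 : ∀ q, (Pi.single q 1 : Q → ZMod 2) ∉ C.rowSpZ) (q : Q) : 1 ≤ degX C q := by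
  by_contra h0
  rw [not_le, Nat.lt_one_iff, degX, card_eq_zero, filter_eq_empty_iff] at h0
  refine hZ1 q (hZlog _ ?_ (by rw [hammingNorm_single_one]; norm_num))
  rw [Matrix.mulVec_single_one]
  funext r
  have := h0 (mem_univ r)
  rw [not_not] at this
  exact this

omit [DecidableEq RX] [DecidableEq RZ] in
/-- **Lemma III.3 (3)**: each qubit is in at most two `X`-checks (three `X`-checks through `q` would force a
`Z`-check through `q` of weight `≥ 4`). [cite: WangLiuLiKubicaGu2026, §III.A Lemma III.3 (3) and proof (arXiv:2601.15446 p. 5)] -/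
theorem A_deg_le_two (C : CSSCode RX RZ Q) (hw : CheckWeightLE C 3)
    (hshare : ∀ r r' : RX, r ≠ r' → #(supp₂ (C.HX r) ∩ supp₂ (C.HX r')) ≤ 1)
    (hdegZ : ∀ q, 1 ≤ degX C.swap q) (q : Q) : degX C q ≤ 2 := by
  by_contra h3
  rw [not_le, degX, two_lt_card_iff] at h3
  obtain ⟨r₁, r₂, r₃, h₁, h₂, h₃, h12, h13, h23⟩ := h3
  simp only [mem_filter, mem_univ, true_and] at h₁ h₂ h₃
  have hs := hdegZ q
  rw [degX, Nat.one_le_iff_ne_zero, Ne, card_eq_zero, filter_eq_empty_iff] at hs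
  push Not at hs
  obtain ⟨s, -, hs⟩ := hs
  rw [swap_HX] at hs
  -- each `X`-check through `q` meets the `Z`-check `s` in a second qubit
  have hsecond : ∀ r, C.HX r q ≠ 0 → ∃ p ∈ supp₂ (C.HX r) ∩ supp₂ (C.HZ s), p ≠ q := by
    intro r hr
    refine exists_mem_ne ?_ q
    have heven := C.even_card_inter_HX_HZ r s
    have hq : q ∈ supp₂ (C.HX r) ∩ supp₂ (C.HZ s) := mem_inter.2 ⟨mem_supp₂.2 hr, mem_supp₂.2 hs⟩
    have hpos : 0 < #(supp₂ (C.HX r) ∩ supp₂ (C.HZ s)) := card_pos.2 ⟨q, hq⟩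
    rcases heven with ⟨m, hm⟩
    omega
  obtain ⟨p₁, hp₁, hp₁q⟩ := hsecond r₁ h₁
  obtain ⟨p₂, hp₂, hp₂q⟩ := hsecond r₂ h₂
  obtain ⟨p₃, hp₃, hp₃q⟩ := hsecond r₃ h₃
  rw [mem_inter] at hp₁ hp₂ hp₃
  -- the second qubits are distinct (two checks share at most one qubit, and they already share `q`)
  have hdist : ∀ {r r' : RX} {p : Q}, r ≠ r' → C.HX r q ≠ 0 → C.HX r' q ≠ 0 → p ≠ q →
      p ∈ supp₂ (C.HX r) → p ∈ supp₂ (C.HX r') → False := by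
    intro r r' p hrr' hr hr' hpq hp hp'
    have h2 : 2 ≤ #(supp₂ (C.HX r) ∩ supp₂ (C.HX r')) := by
      rw [← card_pair hpq]
      refine card_le_card ?_
      intro x hx
      rcases mem_insert.1 hx with rfl | hx
      · exact mem_inter.2 ⟨hp, hp'⟩
      · rw [mem_singleton] at hx; subst hx; exact mem_inter.2 ⟨mem_supp₂.2 hr, mem_supp₂.2 hr'⟩
    have := hshare r r' hrr'
    omega
  have h12' : p₁ ≠ p₂ := fun h => hdist h12 h₁ h₂ hp₁q hp₁.1 (h ▸ hp₂.1)
  have h13' : p₁ ≠ p₃ := fun h => hdist h13 h₁ h₃ hp₁q hp₁.1 (h ▸ hp₃.1)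
  have h23' : p₂ ≠ p₃ := fun h => hdist h23 h₂ h₃ hp₂q hp₂.1 (h ▸ hp₃.1)
  -- so the `Z`-check `s` has weight `≥ 4`
  have h4 : 4 ≤ #(supp₂ (C.HZ s)) := by
    have hsub : ({q, p₁, p₂, p₃} : Finset Q) ⊆ supp₂ (C.HZ s) := by
      intro x hx
      simp only [mem_insert, mem_singleton] at hx
      rcases hx with rfl | rfl | rfl | rfl
      · exact mem_supp₂.2 hs
      · exact hp₁.2
      · exact hp₂.2
      · exact hp₃.2
    have hc : #({q, p₁, p₂, p₃} : Finset Q) = 4 := by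
      rw [card_insert_of_notMem (by simp [hp₁q.symm, hp₂q.symm, hp₃q.symm]),
        card_insert_of_notMem (by simp [h12', h13']), card_pair h23']
    exact hc ▸ card_le_card hsub
  have := hw.2 s
  rw [← card_supp₂] at this
  omega


omit [Fintype RX] [Fintype RZ] [DecidableEq RX] [DecidableEq RZ] in
/-- Parity test for `H *ᵥ ind D = 0`: every row meets `D` evenly. [cite: WangLiuLiKubicaGu2026, §III.A proof of Lemma III.3 (4) (arXiv:2601.15446 p. 5: «X_iX_j and X_iX_k are logical operators»)] -/
theorem mulVec_ind₂_eq_zero {R : Type*} (H : Matrix R Q (ZMod 2)) (D : Finset Q)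
    (h : ∀ r, Even #(supp₂ (H r) ∩ D)) : H *ᵥ ind₂ D = 0 := by
  funext r
  rw [Pi.zero_apply, Matrix.mulVec, dotProduct_eq_zero_iff_even, supp₂_ind₂]
  exact h r

omit [Fintype RX] [Fintype RZ] [Fintype Q] [DecidableEq RX] [DecidableEq RZ] in
/-- `Σ_{q ∈ {a,b,c}} f q = f a + f b + f c` for distinct `a, b, c`. [folklore] -/
private theorem sum_triple {a b c : Q} (hab : a ≠ b) (hac : a ≠ c) (hbc : b ≠ c) (f : Q → ZMod 2) :
    ∑ q ∈ ({a, b, c} : Finset Q), f q = f a + f b + f c := by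
  rw [sum_insert (by simp [hab, hac]), sum_pair hbc, add_assoc]

omit [DecidableEq RX] in
/-- **Lemma III.3 (4), first half**: a weight-3 `Z`-check `Z_aZ_bZ_c` meets another `Z`-check — otherwise `X_aX_b`,
`X_aX_c` are `X`-logicals of weight 2, or stabilizers and then `{a,b,c}` is a disentangled set.
[cite: WangLiuLiKubicaGu2026, §III.A proof of Lemma III.3 (4) (arXiv:2601.15446 p. 5: «This check must coincide with at least one other Z check. Otherwise …»)] -/
theorem A_meet (C : CSSCode RX RZ Q) (hXlog : ∀ v, C.HZ *ᵥ v = 0 → hammingNorm v ≤ 2 → v ∈ C.rowSpX)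
    (hP : ∀ P : Finset Q, P.Nonempty → (∀ r, maskOn P (C.HX r) ∈ C.rowSpX) → (∀ s, maskOn P (C.HZ s) ∈ C.rowSpZ) →
      (∀ u : Q → ZMod 2, (∀ p ∉ P, u p = 0) → C.HZ *ᵥ u = 0 → u ∈ C.rowSpX) → False)
    (s : RZ) (h3 : hammingNorm (C.HZ s) = 3) : 1 ≤ cX C.swap s := by
  by_contra h0
  rw [not_le, Nat.lt_one_iff, cX, card_eq_zero, filter_eq_empty_iff] at h0
  simp only [mem_univ, true_implies, not_and, not_nonempty_iff_eq_empty, swap_HX] at h0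
  rw [← card_supp₂, card_eq_three] at h3
  obtain ⟨a, b, c, hab, hac, hbc, hB⟩ := h3
  have hzs : C.HZ s = ind₂ {a, b, c} := by rw [← hB, ind₂_supp₂]
  -- `X_aX_b`, `X_aX_c` commute with every `Z`-check
  have hlog : ∀ D : Finset Q, D ⊆ {a, b, c} → #D = 2 → ind₂ D ∈ C.rowSpX := by
    intro D hD hD2
    refine hXlog _ (mulVec_ind₂_eq_zero C.HZ D fun s' => ?_) (by rw [hammingNorm_ind₂, hD2])
    by_cases hs' : s' = s
    · subst hs'; rw [hB, inter_eq_right.2 hD, hD2]; exact ⟨1, rfl⟩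
    · have : supp₂ (C.HZ s') ∩ D = ∅ := by
        rw [← subset_empty, ← h0 hs', hB]
        exact fun x hx => mem_inter.2 ⟨hD (mem_inter.1 hx).2, (mem_inter.1 hx).1⟩
      rw [this]; exact ⟨0, rfl⟩
  have hAB : ind₂ {a, b} ∈ C.rowSpX := hlog {a, b} (by intro x; simp only [mem_insert, mem_singleton]; tauto) (card_pair hab)
  have hAC : ind₂ {a, c} ∈ C.rowSpX := hlog {a, c} (by intro x; simp only [mem_insert, mem_singleton]; tauto) (card_pair hac)
  refine hP {a, b, c} ⟨a, by simp⟩ (fun r => ?_) (fun s' => ?_) (fun u hu0 hu => ?_)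
  · -- the `P`-part of an `X`-check has even overlap with `Z_aZ_bZ_c`
    refine mem_of_triple hab hac hbc hAB hAC _ (fun p hp => maskOn_apply_of_not_mem _ _ hp) ?_
    have h := C.HX_dotProduct_HZ r s
    rw [hzs, dotProduct_ind₂, sum_triple hab hac hbc] at h
    simpa [maskOn_apply, hab, hac, hbc] using h
  · -- the `P`-part of a `Z`-check is `0` or `Z_aZ_bZ_c` (it commutes with `X_aX_b` and `X_aX_c`)
    have hb : C.HZ s' a = C.HZ s' b := by
      have hz : C.HZ *ᵥ ind₂ {a, b} = 0 := C.rowSpX_le_kerZ hAB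
      have := congrFun hz s'
      rw [Matrix.mulVec, Pi.zero_apply, dotProduct_ind₂, sum_pair hab] at this
      exact z2_add_eq_zero_iff.1 this
    have hc : C.HZ s' a = C.HZ s' c := by
      have hz : C.HZ *ᵥ ind₂ {a, c} = 0 := C.rowSpX_le_kerZ hAC
      have := congrFun hz s'
      rw [Matrix.mulVec, Pi.zero_apply, dotProduct_ind₂, sum_pair hac] at this
      exact z2_add_eq_zero_iff.1 this
    have : maskOn {a, b, c} (C.HZ s') = C.HZ s' a • C.HZ s := by
      rw [hzs]; funext p
      by_cases hp : p ∈ ({a, b, c} : Finset Q)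
      · have hval : C.HZ s' p = C.HZ s' a := by
          have hp' := hp; simp only [mem_insert, mem_singleton] at hp'
          rcases hp' with rfl | rfl | rfl
          · rfl
          · exact hb.symm
          · exact hc.symm
        simp [hp, hval]
      · simp [hp]
    rw [this]; exact Submodule.smul_mem _ _ (row_mem_rowSpace C.HZ s)
  · refine mem_of_triple hab hac hbc hAB hAC u hu0 ?_
    have h := congrFun hu s
    rw [Matrix.mulVec, Pi.zero_apply, hzs, ind₂_dotProduct, sum_triple hab hac hbc] at h
    exact h

omit [Fintype RX] [Fintype RZ] [Fintype Q] [DecidableEq RX] [DecidableEq RZ] in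
/-- A two-element set meeting a set evenly and nontrivially lies inside it. [folklore] -/
private theorem subset_of_even_inter {A B : Finset Q} (hA : #A = 2) (heven : Even #(A ∩ B)) (hne : (A ∩ B).Nonempty) :
    A ⊆ B := by
  have hle : #(A ∩ B) ≤ 2 := hA ▸ card_le_card inter_subset_left
  have hpos : 0 < #(A ∩ B) := card_pos.2 hne
  have h2 : #(A ∩ B) = 2 := by rcases heven with ⟨m, hm⟩; omega
  have := eq_of_subset_of_card_le inter_subset_left (by rw [hA, h2])
  exact inter_eq_left.1 this

/-- **Lemma III.3 (4), second half**: if the weight-3 `Z`-check `s` meets exactly one other `Z`-check (in the qubit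
`c`, say), then the `X`-check `X_aX_b` on its two other qubits is present and meets another `X`-check — every
alternative is a light logical, a profitable exchange, or a disentangled pair `{a, b}`.
[cite: WangLiuLiKubicaGu2026, §III.A proof of Lemma III.3 (4) (arXiv:2601.15446 p. 5: «Otherwise, suppose there is only one other Z check S₂ coinciding with S₁ … S₃ = X_iX_j … is a check … must coincide with another X check S₄»)] -/
theorem A_partner (C : CSSCode RX RZ Q) (hw : CheckWeightLE C 3)
    (hXlog : ∀ v, C.HZ *ᵥ v = 0 → hammingNorm v ≤ 2 → v ∈ C.rowSpX)
    (hZlog : ∀ v, C.HX *ᵥ v = 0 → hammingNorm v ≤ 2 → v ∈ C.rowSpZ)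
    (hX1 : ∀ q, (Pi.single q 1 : Q → ZMod 2) ∉ C.rowSpX)
    (hXex : ∀ r v, v ∈ C.rowSpX → hammingNorm v < hammingNorm (C.HX r) →
      C.HX r + v ∉ Submodule.span (ZMod 2) (C.HX '' {r' | r' ≠ r}))
    (hshareZ : ∀ s s' : RZ, s ≠ s' → #(supp₂ (C.HZ s) ∩ supp₂ (C.HZ s')) ≤ 1)
    (hP : ∀ P : Finset Q, P.Nonempty → (∀ r, maskOn P (C.HX r) ∈ C.rowSpX) → (∀ s, maskOn P (C.HZ s) ∈ C.rowSpZ) →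
      (∀ u : Q → ZMod 2, (∀ p ∉ P, u p = 0) → C.HZ *ᵥ u = 0 → u ∈ C.rowSpX) → False)
    (s : RZ) (h3 : hammingNorm (C.HZ s) = 3) (h1 : cX C.swap s = 1) :
    ∃ r, supp₂ (C.HX r) ⊆ supp₂ (C.HZ s) ∧ hammingNorm (C.HX r) = 2 ∧ 1 ≤ cX C r := by
  set B := supp₂ (C.HZ s) with hBdef
  rw [← card_supp₂] at h3
  -- the unique other `Z`-check meeting `s`, and their common qubit `c`
  rw [cX, card_eq_one] at h1
  obtain ⟨s', hs'⟩ := h1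
  have hmem : ∀ x, x ∈ univ.filter (fun s'' => s'' ≠ s ∧ (supp₂ (C.swap.HX s) ∩ supp₂ (C.swap.HX s'')).Nonempty) ↔ x = s' := by
    intro x; rw [hs', mem_singleton]
  simp only [mem_filter, mem_univ, true_and, swap_HX] at hmem
  obtain ⟨hs's, hne⟩ := (hmem s').2 rfl
  have hother : ∀ s'', s'' ≠ s → s'' ≠ s' → B ∩ supp₂ (C.HZ s'') = ∅ := by
    intro s'' h1 h2
    by_contra h
    exact h2 ((hmem s'').1 ⟨h1, nonempty_iff_ne_empty.2 h⟩)
  have hcap : #(B ∩ supp₂ (C.HZ s')) = 1 :=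
    le_antisymm (hshareZ s s' (Ne.symm hs's)) (card_pos.2 hne)
  obtain ⟨c, hc⟩ := card_eq_one.1 hcap
  have hcB : c ∈ B := (mem_inter.1 (hc ▸ mem_singleton_self c)).1
  have hcB' : c ∈ supp₂ (C.HZ s') := (mem_inter.1 (hc ▸ mem_singleton_self c)).2
  -- the two other qubits `a, b` of the check `s`
  set D := B.erase c with hDdef
  have hD2 : #D = 2 := by rw [hDdef, card_erase_of_mem hcB, h3]
  have hDB : D ⊆ B := erase_subset c B
  have hcD : c ∉ D := notMem_erase c B
  have hBD : B = insert c D := (insert_erase hcB).symm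
  obtain ⟨a, b, hab, hDab⟩ := card_eq_two.1 hD2
  -- `X_aX_b` commutes with every `Z`-check, hence (no light logical) is an `X`-stabilizer
  have hu : C.HZ *ᵥ ind₂ D = 0 := by
    refine mulVec_ind₂_eq_zero C.HZ D fun s'' => ?_
    by_cases h1 : s'' = s
    · subst h1; rw [inter_eq_right.2 hDB, hD2]; exact ⟨1, rfl⟩
    by_cases h2 : s'' = s'
    · subst h2
      have : supp₂ (C.HZ s'') ∩ D = ∅ := by
        refine eq_empty_of_forall_notMem fun x hx => ?_
        have hx' : x ∈ B ∩ supp₂ (C.HZ s'') := mem_inter.2 ⟨hDB (mem_inter.1 hx).2, (mem_inter.1 hx).1⟩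
        rw [hc, mem_singleton] at hx'
        exact hcD (hx' ▸ (mem_inter.1 hx).2)
      rw [this]; exact ⟨0, rfl⟩
    · have : supp₂ (C.HZ s'') ∩ D = ∅ := by
        rw [← subset_empty, ← hother s'' h1 h2]
        exact fun x hx => mem_inter.2 ⟨hDB (mem_inter.1 hx).2, (mem_inter.1 hx).1⟩
      rw [this]; exact ⟨0, rfl⟩
  have huS : ind₂ D ∈ C.rowSpX := hXlog _ hu (by rw [hammingNorm_ind₂, hD2])
  -- write `X_aX_b` as a product of checks; one factor `r₁` acts on `a`
  obtain ⟨cv, hcv⟩ := (mem_rowSpace_iff C.HX _).1 huS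
  rw [vecMul_eq_sum_smul] at hcv
  have haD : a ∈ D := by rw [hDab]; exact mem_insert_self a {b}
  have hsum : (∑ r, cv r • C.HX r) a ≠ 0 := by rw [hcv]; simp [haD]
  rw [Finset.sum_apply] at hsum
  obtain ⟨r₁, -, hr₁⟩ := exists_ne_zero_of_sum_ne_zero hsum
  rw [Pi.smul_apply, smul_eq_mul, mul_ne_zero_iff] at hr₁
  have hc1 : cv r₁ = 1 := z2_eq_one_of_ne_zero hr₁.1
  -- `x_{r₁} + X_aX_b` is a product of the other checks, so (no profitable exchange) `|x_{r₁}| ≤ 2`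
  have hspan : C.HX r₁ + ind₂ D ∈ Submodule.span (ZMod 2) (C.HX '' {r' | r' ≠ r₁}) := by
    rw [← hcv, ← add_sum_erase _ _ (mem_univ r₁), hc1, one_smul, ← add_assoc]
    have : C.HX r₁ + C.HX r₁ = 0 := by funext q; exact CharTwo.add_self_eq_zero _
    rw [this, zero_add]
    exact Submodule.sum_mem _ fun r hr => Submodule.smul_mem _ _ (Submodule.subset_span ⟨r, ne_of_mem_erase hr, rfl⟩)
  have hle : hammingNorm (C.HX r₁) ≤ 2 := by
    by_contra hlt
    exact hXex r₁ _ huS (by rw [hammingNorm_ind₂, hD2]; omega) hspan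
  have hr0 : C.HX r₁ ≠ 0 := fun h => hr₁.2 (by rw [h]; rfl)
  have hA2 : #(supp₂ (C.HX r₁)) = 2 := by
    rw [card_supp₂]; rcases A_weights C hw hX1 r₁ hr0 with h | h <;> omega
  set A := supp₂ (C.HX r₁) with hAdef
  have haA : a ∈ A := mem_supp₂.2 hr₁.2
  -- `A ⊆ B` (even overlap containing `a`), and `c ∉ A` (else `A ⊆ B'` too and `a = c`), so `A = {a, b}`
  have hAB : A ⊆ B := subset_of_even_inter hA2 (C.even_card_inter_HX_HZ r₁ s) ⟨a, mem_inter.2 ⟨haA, hDB haD⟩⟩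
  have hcA : c ∉ A := by
    intro hcA
    have hAB' : A ⊆ supp₂ (C.HZ s') :=
      subset_of_even_inter hA2 (C.even_card_inter_HX_HZ r₁ s') ⟨c, mem_inter.2 ⟨hcA, hcB'⟩⟩
    have : a ∈ B ∩ supp₂ (C.HZ s') := mem_inter.2 ⟨hAB haA, hAB' haA⟩
    rw [hc, mem_singleton] at this
    exact hcD (this ▸ haD)
  have hAD : A = D := by
    refine eq_of_subset_of_card_le (fun x hx => ?_) (by rw [hA2, hD2])
    have := hAB hx
    rw [hBD, mem_insert] at this
    rcases this with rfl | h
    · exact absurd hx hcA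
    · exact h
  refine ⟨r₁, hAB, by rw [← card_supp₂]; exact hA2, ?_⟩
  -- finally `X_aX_b` meets another `X`-check: otherwise `Z_aZ_b` is a `Z`-stabilizer and `{a, b}` is disentangled
  by_contra h0
  rw [not_le, Nat.lt_one_iff, cX, card_eq_zero, filter_eq_empty_iff] at h0
  simp only [mem_univ, true_implies, not_and, not_nonempty_iff_eq_empty] at h0
  have hw0 : C.HX *ᵥ ind₂ D = 0 := by
    refine mulVec_ind₂_eq_zero C.HX D fun r => ?_
    by_cases h : r = r₁
    · subst h; rw [← hAD, ← hAdef, inter_self, hA2]; exact ⟨1, rfl⟩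
    · rw [inter_comm, ← hAD, h0 h]; exact ⟨0, rfl⟩
  have hwS : ind₂ D ∈ C.rowSpZ := hZlog _ hw0 (by rw [hammingNorm_ind₂, hD2])
  have hnot : ∀ p, p ∉ D → p ∉ ({a, b} : Finset Q) := fun p hp => hDab ▸ hp
  rw [hDab] at huS hwS hu hw0
  refine hP {a, b} ⟨a, by simp⟩ (fun r => ?_) (fun s'' => ?_) (fun u hu0 hu' => ?_)
  · refine mem_of_pair huS _ (fun p hp => maskOn_apply_of_not_mem _ _ hp) ?_
    have := congrFun hw0 r
    rw [Matrix.mulVec, Pi.zero_apply, dotProduct_ind₂, sum_pair hab] at this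
    simpa [maskOn_apply, hab] using this
  · refine mem_of_pair hwS _ (fun p hp => maskOn_apply_of_not_mem _ _ hp) ?_
    have := congrFun hu s''
    rw [Matrix.mulVec, Pi.zero_apply, dotProduct_ind₂, sum_pair hab] at this
    simpa [maskOn_apply, hab] using this
  · refine mem_of_pair huS u hu0 ?_
    have := dotProduct_eq_zero_of_mem_rowSpace hwS hu'
    rwa [dotProduct_ind₂, sum_pair hab] at this


end Analysis

/-! ## Part B.4  The count `2n = 3r₃ + 2r₂ − t`, `t ≥ r₃` (proof of Theorem III.4) -/

section Count

variable [DecidableEq RX] [DecidableEq RZ]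

omit [Fintype RZ] [DecidableEq Q] [DecidableEq RX] [DecidableEq RZ] in
/-- Double counting: total `X`-check weight = `Σ_q deg_X(q)`. [cite: WangLiuLiKubicaGu2026, §III.A proof of Theorem III.4 (arXiv:2601.15446 p. 5, eq. (1): counting the qubits through the checks)] -/
theorem sum_hammingNorm_eq_sum_degX (C : CSSCode RX RZ Q) : ∑ r, hammingNorm (C.HX r) = ∑ q, degX C q := by
  simp only [hammingNorm, degX, card_filter]
  exact sum_comm

omit [Fintype RZ] [DecidableEq RZ] in
/-- With checks sharing `≤ 1` qubit, the number of `X`-checks meeting `x_r` is `Σ_{q ∈ x_r} (deg_X q − 1)`.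
[cite: WangLiuLiKubicaGu2026, §III.A proof of Theorem III.4 (arXiv:2601.15446 p. 5: `t` = number of pairs of intersecting checks = number of shared qubits)] -/
theorem cX_eq_sum (C : CSSCode RX RZ Q) (hsh : ∀ r r' : RX, r ≠ r' → #(supp₂ (C.HX r) ∩ supp₂ (C.HX r')) ≤ 1) (r : RX) :
    cX C r = ∑ q ∈ supp₂ (C.HX r), (degX C q - 1) := by
  have hset : univ.filter (fun r' => r' ≠ r ∧ (supp₂ (C.HX r) ∩ supp₂ (C.HX r')).Nonempty) =
      (supp₂ (C.HX r)).biUnion (fun q => univ.filter fun r' => r' ≠ r ∧ C.HX r' q ≠ 0) := by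
    ext r'
    simp only [mem_filter, mem_univ, true_and, mem_biUnion, mem_supp₂]
    constructor
    · rintro ⟨hne, q, hq⟩
      rw [mem_inter, mem_supp₂, mem_supp₂] at hq
      exact ⟨q, hq.1, hne, hq.2⟩
    · rintro ⟨q, hq, hne, hq'⟩
      exact ⟨hne, q, mem_inter.2 ⟨mem_supp₂.2 hq, mem_supp₂.2 hq'⟩⟩
  have hdisj : ((supp₂ (C.HX r) : Finset Q) : Set Q).PairwiseDisjoint
      (fun q => univ.filter fun r' => r' ≠ r ∧ C.HX r' q ≠ 0) := by
    intro q hq q' hq' hqq'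
    rw [Function.onFun, disjoint_left]
    intro r' h1 h2
    simp only [mem_filter, mem_univ, true_and] at h1 h2
    have h2le : 2 ≤ #(supp₂ (C.HX r) ∩ supp₂ (C.HX r')) := by
      rw [← card_pair hqq']
      refine card_le_card fun x hx => ?_
      rcases mem_insert.1 hx with rfl | hx
      · exact mem_inter.2 ⟨hq, mem_supp₂.2 h1.2⟩
      · rw [mem_singleton] at hx; subst hx; exact mem_inter.2 ⟨hq', mem_supp₂.2 h2.2⟩
    have := hsh r r' (Ne.symm h1.1)
    omega
  rw [cX, hset, card_biUnion hdisj]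
  refine sum_congr rfl fun q hq => ?_
  have : univ.filter (fun r' => r' ≠ r ∧ C.HX r' q ≠ 0) = (univ.filter fun r' => C.HX r' q ≠ 0).erase r := by
    ext r'; simp only [mem_filter, mem_univ, true_and, mem_erase]
  have hr : r ∈ univ.filter (fun r' => C.HX r' q ≠ 0) := mem_filter.2 ⟨mem_univ _, mem_supp₂.1 hq⟩
  rw [this, card_erase_of_mem hr, degX]

omit [Fintype RZ] [DecidableEq Q] [DecidableEq RX] [DecidableEq RZ] in
/-- Double counting with weights: `Σ_r Σ_{q ∈ x_r} f(q) = Σ_q deg_X(q) f(q)`. [cite: WangLiuLiKubicaGu2026, §III.A proof of Theorem III.4 (arXiv:2601.15446 p. 5, eq. (1))] -/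
theorem sum_sum_supp₂_eq (C : CSSCode RX RZ Q) (f : Q → ℕ) :
    ∑ r, ∑ q ∈ supp₂ (C.HX r), f q = ∑ q, degX C q * f q := by
  have : ∀ r, ∑ q ∈ supp₂ (C.HX r), f q = ∑ q, if C.HX r q ≠ 0 then f q else 0 := fun r => by
    rw [supp₂, sum_filter]
  simp only [this]
  rw [sum_comm]
  refine sum_congr rfl fun q _ => ?_
  rw [← sum_filter, sum_const, smul_eq_mul, degX]

omit [Fintype RZ] [DecidableEq RZ] in
/-- **Equation (1)** of the printed proof, `X`-part: `Σ_r c_X(r) + 2n = 2 Σ_r |x_r|` when every qubit is in one or two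
`X`-checks and checks share `≤ 1` qubit (so `t_X = Σ|x_r| − n`). [cite: WangLiuLiKubicaGu2026, §III.A proof of Theorem III.4 (arXiv:2601.15446 p. 5, eq. (1) `2n = 3r₃ + 2r₂ − t`)] -/
theorem count_identity (C : CSSCode RX RZ Q) (hsh : ∀ r r' : RX, r ≠ r' → #(supp₂ (C.HX r) ∩ supp₂ (C.HX r')) ≤ 1)
    (hdeg : ∀ q, 1 ≤ degX C q ∧ degX C q ≤ 2) :
    ∑ r ∈ nzX C, cX C r + 2 * Fintype.card Q = 2 * ∑ r, hammingNorm (C.HX r) := by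
  have h1 : ∑ r ∈ nzX C, cX C r = ∑ q, degX C q * (degX C q - 1) := by
    rw [← sum_sum_supp₂_eq]
    rw [← sum_subset (subset_univ (nzX C))]
    · exact sum_congr rfl fun r _ => cX_eq_sum C hsh r
    · intro r _ hr
      rw [nzX, mem_filter, not_and, not_not] at hr
      rw [supp₂_eq_empty_iff.2 (hr (mem_univ r)), sum_empty]
  rw [h1, sum_hammingNorm_eq_sum_degX, ← card_univ, card_eq_sum_ones, mul_sum, mul_sum, ← sum_add_distrib]
  refine sum_congr rfl fun q _ => ?_
  obtain ⟨h1, h2⟩ := hdeg q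
  interval_cases (degX C q) <;> rfl

omit [Fintype RZ] [DecidableEq Q] [DecidableEq RZ] in
/-- `Σ_r |x_r| = 2 r₂ + 3 r₃` and `#(nonzero X-checks) = r₂ + r₃` when every nonzero check has weight 2 or 3.
[cite: WangLiuLiKubicaGu2026, §III.A proof of Theorem III.4 (arXiv:2601.15446 p. 5: `r = r₂ + r₃`, `3r₃ + 2r₂`)] -/
theorem sum_hammingNorm_eq_two_three (C : CSSCode RX RZ Q)
    (hw23 : ∀ r, C.HX r ≠ 0 → hammingNorm (C.HX r) = 2 ∨ hammingNorm (C.HX r) = 3) :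
    ∑ r, hammingNorm (C.HX r) = 2 * #(univ.filter fun r => hammingNorm (C.HX r) = 2) +
        3 * #(univ.filter fun r => hammingNorm (C.HX r) = 3) ∧
      #(nzX C) = #(univ.filter fun r => hammingNorm (C.HX r) = 2) + #(univ.filter fun r => hammingNorm (C.HX r) = 3) := by
  set T2 := univ.filter fun r => hammingNorm (C.HX r) = 2
  set T3 := univ.filter fun r => hammingNorm (C.HX r) = 3
  have hnz : nzX C = T2 ∪ T3 := by
    ext r
    simp only [nzX, T2, T3, mem_filter, mem_univ, true_and, mem_union]
    constructor
    · exact hw23 r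
    · rintro (h | h) <;> · intro h0; rw [h0, hammingNorm_zero] at h; omega
  have hdisj : Disjoint T2 T3 := by
    rw [disjoint_filter]; intro r _ h2 h3; omega
  have hsum : ∑ r, hammingNorm (C.HX r) = ∑ r ∈ nzX C, hammingNorm (C.HX r) := by
    rw [← sum_subset (subset_univ (nzX C))]
    intro r _ hr
    rw [nzX, mem_filter, not_and, not_not] at hr
    rw [hr (mem_univ r), hammingNorm_zero]
  refine ⟨?_, by rw [hnz, card_union_of_disjoint hdisj]⟩
  rw [hsum, hnz, sum_union hdisj]
  have e2 : ∑ r ∈ T2, hammingNorm (C.HX r) = ∑ r ∈ T2, 2 := sum_congr rfl fun r hr => (mem_filter.1 hr).2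
  have e3 : ∑ r ∈ T3, hammingNorm (C.HX r) = ∑ r ∈ T3, 3 := sum_congr rfl fun r hr => (mem_filter.1 hr).2
  rw [e2, e3, sum_const, sum_const, smul_eq_mul, smul_eq_mul]; ring

/-- **Lemma III.3 (4) as an inequality** (the charging): `2 r₃^X + #(weight-2 X-checks with a partner) ≤
Σ_r c_X(r) + #(weight-2 Z-checks with a partner)`; summed with its `X ↔ Z` mirror it gives `t ≥ r₃`.
[cite: WangLiuLiKubicaGu2026, §III.A Lemma III.3 (4) and proof (arXiv:2601.15446 p. 5: «associate every weight-3 check with two ordered pairs of intersecting checks of same type»)] -/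
theorem charging (C : CSSCode RX RZ Q)
    (hshX : ∀ r r' : RX, r ≠ r' → #(supp₂ (C.HX r) ∩ supp₂ (C.HX r')) ≤ 1)
    (hm : ∀ r, hammingNorm (C.HX r) = 3 → 1 ≤ cX C r)
    (hp : ∀ r, hammingNorm (C.HX r) = 3 → cX C r = 1 →
      ∃ s, supp₂ (C.HZ s) ⊆ supp₂ (C.HX r) ∧ hammingNorm (C.HZ s) = 2 ∧ 1 ≤ cX C.swap s) :
    2 * #(univ.filter fun r => hammingNorm (C.HX r) = 3) +
        #(univ.filter fun r => hammingNorm (C.HX r) = 2 ∧ 1 ≤ cX C r) ≤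
      ∑ r ∈ nzX C, cX C r + #(univ.filter fun s => hammingNorm (C.HZ s) = 2 ∧ 1 ≤ cX C.swap s) := by
  set T3 := univ.filter fun r => hammingNorm (C.HX r) = 3
  set T3a := univ.filter fun r => hammingNorm (C.HX r) = 3 ∧ 2 ≤ cX C r
  set T3b := univ.filter fun r => hammingNorm (C.HX r) = 3 ∧ cX C r = 1
  set T2p := univ.filter fun r => hammingNorm (C.HX r) = 2 ∧ 1 ≤ cX C r
  set T2pZ := univ.filter fun s => hammingNorm (C.HZ s) = 2 ∧ 1 ≤ cX C.swap s
  -- `T3 = T3a ⊔ T3b` since every weight-3 check has a partner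
  have hT3 : #T3 = #T3a + #T3b := by
    rw [← card_filter_add_card_filter_not (s := T3) (fun r => 2 ≤ cX C r)]
    congr 1
    · congr 1; ext r; simp [T3, T3a]
    · congr 1; ext r
      simp only [T3, T3b, mem_filter, mem_univ, true_and, not_le]
      constructor
      · rintro ⟨h3, hlt⟩; have := hm r h3; exact ⟨h3, by omega⟩
      · rintro ⟨h3, h1⟩; exact ⟨h3, by omega⟩
  -- the three classes are disjoint subsets of the nonzero checks
  have hsub : T3a ∪ T3b ∪ T2p ⊆ nzX C := by
    intro r hr
    simp only [mem_union, T3a, T3b, T2p, mem_filter, mem_univ, true_and] at hr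
    rw [nzX, mem_filter]
    refine ⟨mem_univ _, fun h0 => ?_⟩
    rw [h0, hammingNorm_zero] at hr
    omega
  have hd1 : Disjoint T3a T3b := by rw [disjoint_filter]; intro r _ h1 h2; omega
  have hd2 : Disjoint (T3a ∪ T3b) T2p := by
    rw [disjoint_union_left, disjoint_filter, disjoint_filter]; constructor <;> (intro r _ h1 h2; omega)
  have hge : 2 * #T3a + #T3b + #T2p ≤ ∑ r ∈ nzX C, cX C r := by
    refine le_trans ?_ (sum_le_sum_of_subset hsub)
    rw [sum_union hd2, sum_union hd1]
    have ha : #T3a • 2 ≤ ∑ r ∈ T3a, cX C r := card_nsmul_le_sum _ _ _ fun r hr => (mem_filter.1 hr).2.2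
    have hb : #T3b • 1 ≤ ∑ r ∈ T3b, cX C r := card_nsmul_le_sum _ _ _ fun r hr => by rw [(mem_filter.1 hr).2.2]
    have hc : #T2p • 1 ≤ ∑ r ∈ T2p, cX C r := card_nsmul_le_sum _ _ _ fun r hr => (mem_filter.1 hr).2.2
    rw [smul_eq_mul] at ha hb hc
    omega
  -- the injection `T3b → T2pZ`, `r ↦` the weight-2 `Z`-check inside `x_r`
  have hinj : #T3b ≤ #T2pZ := by
    refine card_le_card_of_forall_subsingleton (fun r s => supp₂ (C.HZ s) ⊆ supp₂ (C.HX r) ∧ hammingNorm (C.HZ s) = 2)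
      (fun r hr => ?_) (fun s hs r hr r' hr' => ?_)
    · obtain ⟨h3, h1⟩ := (mem_filter.1 hr).2
      obtain ⟨s, hs, hs2, hsc⟩ := hp r h3 h1
      exact ⟨s, mem_filter.2 ⟨mem_univ _, hs2, hsc⟩, hs, hs2⟩
    · simp only [Set.mem_setOf_eq] at hr hr'
      by_contra hne
      have h2 : 2 ≤ #(supp₂ (C.HX r) ∩ supp₂ (C.HX r')) := by
        have h2' : #(supp₂ (C.HZ s)) = 2 := by rw [card_supp₂]; exact hr.2.2
        rw [← h2']
        exact card_le_card (subset_inter hr.2.1 hr'.2.1)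
      have := hshX r r' hne
      omega
  omega

/-- **Proof of Theorem III.4, terminal case**: a CSS code with the structure of Lemma III.3 on both check types
(weights 2/3, checks sharing `≤ 1` qubit, independent checks, qubit degrees 1 or 2, and the partner structure of
Lemma III.3 (4)) has `k = 0`: `2n = 3r₃ + 2r₂ − t ≤ 2r`. [cite: WangLiuLiKubicaGu2026, §III.A Theorem III.4 and proof (arXiv:2601.15446 p. 5, eqs. (1)–(2))] -/
theorem k_eq_zero_of_structure (C : CSSCode RX RZ Q)
    (hwX : ∀ r, C.HX r ≠ 0 → hammingNorm (C.HX r) = 2 ∨ hammingNorm (C.HX r) = 3)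
    (hwZ : ∀ s, C.HZ s ≠ 0 → hammingNorm (C.HZ s) = 2 ∨ hammingNorm (C.HZ s) = 3)
    (hshX : ∀ r r' : RX, r ≠ r' → #(supp₂ (C.HX r) ∩ supp₂ (C.HX r')) ≤ 1)
    (hshZ : ∀ s s' : RZ, s ≠ s' → #(supp₂ (C.HZ s) ∩ supp₂ (C.HZ s')) ≤ 1)
    (hdX : ∀ q, 1 ≤ degX C q ∧ degX C q ≤ 2) (hdZ : ∀ q, 1 ≤ degX C.swap q ∧ degX C.swap q ≤ 2)
    (hmX : ∀ r, hammingNorm (C.HX r) = 3 → 1 ≤ cX C r) (hmZ : ∀ s, hammingNorm (C.HZ s) = 3 → 1 ≤ cX C.swap s)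
    (hpX : ∀ r, hammingNorm (C.HX r) = 3 → cX C r = 1 →
      ∃ s, supp₂ (C.HZ s) ⊆ supp₂ (C.HX r) ∧ hammingNorm (C.HZ s) = 2 ∧ 1 ≤ cX C.swap s)
    (hpZ : ∀ s, hammingNorm (C.HZ s) = 3 → cX C.swap s = 1 →
      ∃ r, supp₂ (C.HX r) ⊆ supp₂ (C.HZ s) ∧ hammingNorm (C.HX r) = 2 ∧ 1 ≤ cX C r)
    (hrkX : C.HX.rank = #(nzX C)) (hrkZ : C.HZ.rank = #(nzX C.swap)) : C.k = 0 := by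
  have eX := count_identity C hshX hdX
  have eZ := count_identity C.swap hshZ hdZ
  have cgX := charging C hshX hmX hpX
  have cgZ := charging C.swap hshZ hmZ (by simpa only [swap_swap, swap_HX, swap_HZ] using hpZ)
  obtain ⟨wX, nX⟩ := sum_hammingNorm_eq_two_three C hwX
  obtain ⟨wZ, nZ⟩ := sum_hammingNorm_eq_two_three C.swap hwZ
  simp only [swap_HX, swap_HZ, swap_swap] at eZ cgZ wZ nZ
  rw [k_eq, hrkX, hrkZ, nX, nZ]
  omega

end Count

/-! ## Part B.5  Theorem III.4 -/

section Main

omit [Fintype RZ] [DecidableEq Q] in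
/-- A CSS code has `k ≤ n` (private copy of `CSSCode.k_le_card` of `CSSErasureCapacityConverse.lean`, not imported
here). [cite: NielsenChuang2010, §10.4.2 p. 450 (C₂ ⊂ C₁, an [n, k₁ − k₂] code)] -/
private theorem k_le_card_aux (C : CSSCode RX RZ Q) : C.k ≤ Fintype.card Q := by
  rw [k_eq]; omega

universe u v w in
/-- **The descent** (the printed «minimal code of CSS(3)» argument, run as a strong induction on `n + wt(C)`): every
CSS code with check weight `≤ 3` and `k > 0` has `min (d^X, d^Z) ≤ 2`.
[cite: WangLiuLiKubicaGu2026, §III.A Theorem III.4 and proof, with Lemma III.3 and Definitions III.1–III.2 (arXiv:2601.15446 pp. 4–5)] -/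
theorem min_dX_dZ_le_two_of_meas_le (N : ℕ) :
    ∀ {RX : Type u} {RZ : Type v} {Q : Type w} [Fintype RX] [Fintype RZ] [Fintype Q] [DecidableEq Q]
      (C : CSSCode RX RZ Q), meas C ≤ N → CheckWeightLE C 3 → 0 < C.k → min C.dX C.dZ ≤ 2 := by
  induction N with
  | zero =>
    intro RX RZ Q _ _ _ _ C hN _ hk
    have : Fintype.card Q = 0 := by unfold meas at hN; omega
    have := k_le_card_aux C
    omega
  | succ N ihN =>
    intro RX RZ Q _ _ _ _ C hN hw hk
    classical
    have ih : DescentIH C := fun C' hm hw' hk' => ihN C' (by omega) hw' hk'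
    by_contra hG
    -- every reduction is unavailable
    have hXlog : ∀ v, C.HZ *ᵥ v = 0 → hammingNorm v ≤ 2 → v ∈ C.rowSpX :=
      fun v hv h2 => by_contra fun hv' => hG (step_logicalX C hv hv' h2)
    have hZlog : ∀ v, C.HX *ᵥ v = 0 → hammingNorm v ≤ 2 → v ∈ C.rowSpZ :=
      fun v hv h2 => by_contra fun hv' => hG (step_logicalZ C hv hv' h2)
    have hX1 : ∀ q, (Pi.single q 1 : Q → ZMod 2) ∉ C.rowSpX := fun q h => hG (step_punctureX C hw hk ih q h)
    have hZ1 : ∀ q, (Pi.single q 1 : Q → ZMod 2) ∉ C.rowSpZ := fun q h => hG (step_punctureZ C hw hk ih q h)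
    have hXex : ∀ r v, v ∈ C.rowSpX → hammingNorm v < hammingNorm (C.HX r) →
        C.HX r + v ∉ Submodule.span (ZMod 2) (C.HX '' {r' | r' ≠ r}) :=
      fun r v hv hlt hr => hG (step_exchX C hw hk ih r v hv hlt hr)
    have hZex : ∀ s v, v ∈ C.rowSpZ → hammingNorm v < hammingNorm (C.HZ s) →
        C.HZ s + v ∉ Submodule.span (ZMod 2) (C.HZ '' {s' | s' ≠ s}) :=
      fun s v hv hlt hr => hG (step_exchZ C hw hk ih s v hv hlt hr)
    have hP : ∀ P : Finset Q, P.Nonempty → (∀ r, maskOn P (C.HX r) ∈ C.rowSpX) →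
        (∀ s, maskOn P (C.HZ s) ∈ C.rowSpZ) →
        (∀ u : Q → ZMod 2, (∀ p ∉ P, u p = 0) → C.HZ *ᵥ u = 0 → u ∈ C.rowSpX) → False :=
      fun P hP hX hZ hMX => hG (step_punctureSet C hw hk ih P hP hX hZ hMX)
    have hP' : ∀ P : Finset Q, P.Nonempty → (∀ s, maskOn P (C.HZ s) ∈ C.rowSpZ) →
        (∀ r, maskOn P (C.HX r) ∈ C.rowSpX) →
        (∀ u : Q → ZMod 2, (∀ p ∉ P, u p = 0) → C.HX *ᵥ u = 0 → u ∈ C.rowSpZ) → False := by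
      intro P hP hZ hX hMZ
      have := step_punctureSet C.swap (checkWeightLE_swap hw) (by rwa [k_swap]) ih.swap P hP hZ hX hMZ
      rw [dX_swap, dZ_swap, min_comm] at this
      exact hG this
    have hw' := checkWeightLE_swap hw
    -- the structure of Lemma III.3, on both check types
    have wX := A_weights C hw hX1
    have wZ := A_weights C.swap hw' hZ1
    have shX : ∀ r r' : RX, r ≠ r' → #(supp₂ (C.HX r) ∩ supp₂ (C.HX r')) ≤ 1 := fun r r' h => A_share C hw hXex h
    have shZ : ∀ s s' : RZ, s ≠ s' → #(supp₂ (C.HZ s) ∩ supp₂ (C.HZ s')) ≤ 1 := fun s s' h => A_share C.swap hw' hZex h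
    have rkX := A_rank C hXex
    have rkZ := A_rank C.swap hZex
    have dX1 := A_deg_pos C hZlog hZ1
    have dZ1 := A_deg_pos C.swap hXlog hX1
    have dX2 := A_deg_le_two C hw shX dZ1
    have dZ2 := A_deg_le_two C.swap hw' shZ (by simpa only [swap_swap] using dX1)
    have mZ := A_meet C hXlog hP
    have mX := A_meet C.swap hZlog hP'
    have pZ := A_partner C hw hXlog hZlog hX1 hXex shZ hP
    have pX := A_partner C.swap hw' hZlog hXlog hZ1 hZex shX hP'
    simp only [swap_swap, swap_HX, swap_HZ] at mX pX
    have hk0 := k_eq_zero_of_structure C wX wZ shX shZ (fun q => ⟨dX1 q, dX2 q⟩) (fun q => ⟨dZ1 q, dZ2 q⟩)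
      mX mZ pX pZ rkX rkZ
    omega

/-- **Wang–Liu–Li–Kubica–Gu 2026, Theorem III.4.** «An `[[n, k, d]]` CSS code with check weight 3 must have either
distance `d ≤ 2` or dimension `k = 0`.» In the tree's check-matrix language (`CSS.lean`): if every row of `H^X` and of
`H^Z` has Hamming weight `≤ 3` and `k > 0`, then `min (d^X, d^Z) ≤ 2`. No hypothesis on the qubit degree or on
the number of checks. [cite: WangLiuLiKubicaGu2026, §III.A Theorem III.4 (arXiv:2601.15446 p. 5)] -/
theorem WangLiuLiKubicaGu2026_theorem_III4 (C : CSSCode RX RZ Q) (hX : ∀ r, hammingNorm (C.HX r) ≤ 3)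
    (hZ : ∀ s, hammingNorm (C.HZ s) ≤ 3) (hk : 0 < C.k) : min C.dX C.dZ ≤ 2 :=
  min_dX_dZ_le_two_of_meas_le (meas C) C le_rfl ⟨hX, hZ⟩ hk

/-- **Theorem III.4 for the census predicate**: an `[[n, k, d]]` CSS code (`CSSCode.IsCode`, so `k > 0` and
`d = min (d^X, d^Z)`) with check weight `≤ 3` has `d ≤ 2`. [cite: WangLiuLiKubicaGu2026, §III.A Theorem III.4 (arXiv:2601.15446 p. 5)] -/
theorem WangLiuLiKubicaGu2026_theorem_III4_isCode (C : CSSCode RX RZ Q) (hX : ∀ r, hammingNorm (C.HX r) ≤ 3)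
    (hZ : ∀ s, hammingNorm (C.HZ s) ≤ 3) {n k d : ℕ} (h : C.IsCode n k d) : d ≤ 2 := by
  have hk : 0 < C.k := h.2.1.symm ▸ h.k_pos
  obtain ⟨-, -, hmin⟩ := (C.isCode_iff hk).1 h
  rw [← hmin]
  exact WangLiuLiKubicaGu2026_theorem_III4 C hX hZ hk

end Main

end CSSCode

end Literature.InformationTheory.QuantumCodes
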